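import Literature.Topology.FourManifolds.SurgeryTubeTransition
import Literature.Topology.FourManifolds.SurgeryTwistChoice
import Literature.Topology.FourManifolds.SurgeryHandleCylinderFrame
import Literature.Geometry.Manifold.OpenSubmanifoldMFDeriv
import Mathlib.Analysis.Calculus.Deriv.Inv
import HarnessLib

/-!
# Re-framing a framed sphere so that the surgered manifold is s-parallelizable (Kervaire–Milnor, Lemma 6.2 / 5.4)

Topic `Literature/Topology/FourManifolds` (fact seat of
`Literature.Topology.FourManifolds.HomotopySphere.boundsContractible_of_nullCobordism_isStablyParallelizable_four`).
This module assembles, on top of the cylinder-frame files `SurgeryCylinderFrames`,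
`SurgeryTubeCylinderFrame`, `SurgeryTubeTransition`, `SurgeryTwistChoice`, `SurgeryHandleCylinderFrame`
and B. Kervaire–Milnor §6 linear algebra `SurgerySwapMatrix`, the proof of

* `FramedSphereFamily.exists_twist_isStablyParallelizable_surgered` — **Kervaire–Milnor 1963,
  Lemma 6.2 with Lemma 5.4**: if `X` is an s-parallelizable compact manifold and `ν` a framed
  `k`-sphere in its interior with `k < l + 1` (`dim X = k + l + 1`), then for a suitable re-framing
  `T` (`ν.twist`) the surgered manifold `χ(X, ν_T)` is s-parallelizable.

It is organised in four parts (originally drafted as four files):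

1. `SurgeryTubeTwistNull` — Lemma 6.2, matrix form: `twistMat_ofMatrix` (the matrix of the twisting
   map of `TwistData.ofMatrix α` is `1_{k+1} ⊕ α(u)`), `coreTrans`, and
   `exists_twist_coreTrans_homotopic_one` (some re-framing makes the core transition
   `Sᵏ → GL_{n+2}` null-homotopic; stable-range surjectivity `StableRangeGLPeel`).
2. `SurgeryOverlapTransition` — the overlap of the two pieces in cone coordinates: bridge lemmas
   `hasMFDerivAt_prodSelf(_prodSelf)_iff`, Milnor's `thetaMap (y, x) = (y, ‖y‖ x/‖x‖)` and its
   derivative, radial invariance `mfderiv_cone_smul`, `coe_glue_symm_handleCone`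
   (`glue⁻¹ ∘ Ψ = φ̂ ∘ Θ`) and the chain identity `mfderiv_glue_symm_comp_handleDeriv`
   (`d(glue⁻¹) ∘ dΨ = dφ̂_{(u,θv)} ∘ KK (u, v) θ`).
3. `SurgeryOverlapComparison` — the framing `S` of `X` transported to the handle (`strFrame`), the
   overlap comparison matrix `overlapTrans` (continuous on `0 < ‖y‖ < 1`) and its formula
   `overlapTrans (θu, v) = (Xmat (u, v) θ)⁻¹ · tubeTrans (u, θv)` (`cylR_eq_act` + chain identity).
4. `SurgeryHandleFrameAssembly` — the slice `(u, v) ↦ overlapTrans (u/4, v)` is null-homotopic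
   (`Xmat_homotopic_const`, radial contraction onto the core transition), the interpolating matrix
   field `blendMat`, the handle framing `handleSFrame`, the seam matching `handleSFrame_match`, and
   the theorem, by `isStablyParallelizable_surgered_of_seam` (`SurgeredStableFrameGlue.lean`).

Everything is proved; the `def`s are explicit constructions; no named facts (D-0026).

## References

* M. Kervaire, J. Milnor, *Groups of homotopy spheres I*, Ann. of Math. (2) 77 (1963), Lemma 5.4
  (p. 514), §6, Lemmas 6.1–6.2 (pp. 520–522). doi:10.2307/1970128 [KervaireMilnorAnnals1963]
* J. Milnor, *Lectures on the h-cobordism theorem* (1965), Def. 3.11. [MilnorHCobordism1965]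
* A. Kosinski, *Differential Manifolds* (1993), Ch. X §2, Lemma (2.1), p. 200. [Kosinski1993]
-/

/-! ## Part: `SurgeryTubeTwistNull` -/

noncomputable section

open scoped Manifold ContDiff Topology RealInnerProductSpace Matrix
open Set Function Bundle Metric Module

namespace Literature.Topology.FourManifolds

open StableFrames StableFrames.SurgerySwap StableFrames.NzMat

namespace FramedSphereFamily

universe u

attribute [local instance] fact_finrank_euclideanSpace_succ

section MatrixIdentity

variable {n k l : ℕ} (h : k + 1 + (l + 1) = n + 1 + 1) (e : l + 1 + (k + 1) = n + 1 + 1)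
  (α : Metric.sphere (0 : EuclideanSpace ℝ (Fin (k + 1))) 1 → Matrix (Fin (l + 1)) (Fin (l + 1)) ℝ)
  (hα : ∀ i j, ContMDiff (𝓡 k) 𝓘(ℝ) ∞ fun u => α u i j) (hdet : ∀ u, (α u).det ≠ 0)

/-- Entries of the twisting matrix: `[twistLin]_{ij} = ⟪(bᵢ)₁, (bⱼ)₁⟫ + ⟪(bᵢ)₂, a(u) (bⱼ)₂⟫`.
[folklore] -/
theorem twistMat_apply (T : TwistData k (l + 1)) (u : Metric.sphere (0 : EuclideanSpace ℝ (Fin (k + 1))) 1)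
    (i j : Fin (n + 1 + 1)) :
    twistMat h T u i j = ⟪(jbasis h i).1, (jbasis h j).1⟫ + ⟪(jbasis h i).2, T.a u (jbasis h j).2⟫ := by
  rw [twistMat, LinearMap.toMatrix_apply, jbasis_repr_apply]
  rfl

/-- **The matrix of the twisting map of `ofMatrix α` is the block matrix `1_{k+1} ⊕ α(u)`.**
[cite: KervaireMilnorAnnals1963, Lemma 6.1 (p. 521)] -/
theorem twistMat_ofMatrix (u : Metric.sphere (0 : EuclideanSpace ℝ (Fin (k + 1))) 1) :
    twistMat h (TwistData.ofMatrix α hα hdet) u = (castEq e (stabPow (k + 1) ⟨α u, hdet u⟩)).1 := by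
  ext i j
  rw [twistMat_apply, castEq_val_apply]
  have hval_inl : ∀ a : Fin (k + 1), (Fin.cast e.symm (finCongr h (finSumFinEquiv (Sum.inl a)))).1 = a := by
    intro a; simp
  have hval_inr : ∀ b : Fin (l + 1), Fin.cast e.symm (finCongr h (finSumFinEquiv (Sum.inr b))) = b.addNat (k + 1) := by
    intro b; apply Fin.ext; simp only [Fin.val_cast, finCongr_apply, finSumFinEquiv_apply_right,
      Fin.val_natAdd, Fin.val_addNat]; omega
  rcases exists_index h i with ⟨a, rfl⟩ | ⟨b, rfl⟩
  · -- row from the first factor: identity row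
    rw [stabPow_val_of_lt_left _ _ _ _ (by rw [hval_inl]; exact a.2)]
    rcases exists_index h j with ⟨a', rfl⟩ | ⟨b', rfl⟩
    · rw [jbasis_inl, jbasis_inl]
      by_cases haa : a = a'
      · subst haa
        rw [if_pos rfl]
        simp
      · have h1 : (finCongr h (finSumFinEquiv (Sum.inl a)) : Fin (n + 1 + 1)) ≠
            finCongr h (finSumFinEquiv (Sum.inl a')) := by
          intro hh; exact haa (Sum.inl_injective (finSumFinEquiv.injective ((finCongr h).injective hh)))
        have h2 : Fin.cast e.symm (finCongr h (finSumFinEquiv (Sum.inl a))) ≠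
            Fin.cast e.symm (finCongr h (finSumFinEquiv (Sum.inl a'))) :=
          fun hh => h1 (Fin.cast_injective _ hh)
        rw [if_neg h2]
        simp [EuclideanSpace.inner_single_left, haa]
    · rw [jbasis_inl, jbasis_inr]
      have h2 : Fin.cast e.symm (finCongr h (finSumFinEquiv (Sum.inl a))) ≠
          Fin.cast e.symm (finCongr h (finSumFinEquiv (Sum.inr b'))) := by
        intro hh
        have := congrArg Fin.val hh
        rw [hval_inr, hval_inl] at this
        simp only [Fin.val_addNat] at this; omega
      rw [if_neg h2]
      simp
  · rcases exists_index h j with ⟨a', rfl⟩ | ⟨b', rfl⟩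
    · -- column from the first factor: identity column
      rw [stabPow_val_of_lt_right _ _ _ _ (by rw [hval_inl]; exact a'.2), jbasis_inr, jbasis_inl]
      have h2 : Fin.cast e.symm (finCongr h (finSumFinEquiv (Sum.inr b))) ≠
          Fin.cast e.symm (finCongr h (finSumFinEquiv (Sum.inl a'))) := by
        intro hh
        have := congrArg Fin.val hh
        rw [hval_inr, hval_inl] at this
        simp only [Fin.val_addNat] at this; omega
      rw [if_neg h2]
      simp
    · -- the fibre block
      rw [hval_inr, hval_inr, stabPow_val_addNat, jbasis_inr, jbasis_inr]
      simp only [inner_zero_left, zero_add]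
      rw [TwistData.ofMatrix_a_apply, EuclideanSpace.inner_single_left]
      simp [Matrix.mulVec, dotProduct]

end MatrixIdentity

section Choice

variable {n k l : ℕ} {X : Type u} [TopologicalSpace X] [ChartedSpace (EuclideanHalfSpace (n + 1)) X]
  [IsManifold (𝓡∂ (n + 1)) ∞ X] {ι : Type u}
  (ν : FramedSphereFamily (𝓡∂ (n + 1)) X ι k (l + 1)) (i : ι) (h : k + 1 + (l + 1) = n + 1 + 1)
  (S : SFrame n X)

/-- The core transition of `ν` as a continuous map `Sᵏ → GL_{n+2}(ℝ)` (Kervaire–Milnor's `g`,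
§6 p. 521). [cite: KervaireMilnorAnnals1963, §6 p. 521] -/
def coreTrans : C(Metric.sphere (0 : EuclideanSpace ℝ (Fin (k + 1))) 1, NzMat (n + 1 + 1)) :=
  ⟨fun u => ⟨ν.tubeTrans i h S (u, 0), ν.det_tubeTrans_ne_zero i h S _⟩,
    ((ν.continuous_tubeTrans i h S).comp (Continuous.prodMk_left (0 : EuclideanSpace ℝ (Fin (l + 1))))).subtype_mk _⟩

/-- Values of `coreTrans`. [folklore] -/
@[simp] theorem coreTrans_apply_val (u : Metric.sphere (0 : EuclideanSpace ℝ (Fin (k + 1))) 1) :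
    (ν.coreTrans i h S u).1 = ν.tubeTrans i h S (u, 0) := rfl

/-- **Kervaire–Milnor's Lemma 6.2, matrix form: the core transition can be killed by re-framing.**
For `k < l + 1` there is a re-framing `T` of the framed `k`-spheres such that the core transition
of `ν.twist T` — the stable framing `S` of `X` read in the tube cylinder frame along the core — is
homotopic to the constant `1` in `GL_{n+2}(ℝ)`. [cite: KervaireMilnorAnnals1963, Lemma 6.2 (p. 522)] -/
theorem exists_twist_coreTrans_homotopic_one (hk : k < l + 1) :
    ∃ T : TwistData k (l + 1), ((ν.twist fun _ => T).coreTrans i h S).Homotopic (1 : C(_, NzMat (n + 1 + 1))) := by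
  have e : l + 1 + (k + 1) = n + 1 + 1 := by omega
  obtain ⟨α, hdet, hsm, hc, hβ⟩ := exists_smooth_stabPow_homotopic hk e (ν.coreTrans i h S)
  refine ⟨TwistData.ofMatrix α hsm hdet, ?_⟩
  set T := TwistData.ofMatrix α hsm hdet with hT
  set M : C(Metric.sphere (0 : EuclideanSpace ℝ (Fin (k + 1))) 1, NzMat (n + 1 + 1)) :=
    castEqMap e (stabPowMap (k + 1) ⟨_, hc⟩) with hM
  -- the twisted core transition is `M⁻¹ · coreTrans`
  have hval : (ν.twist fun _ => T).coreTrans i h S = (invMap _).comp M * ν.coreTrans i h S := by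
    ext u : 1
    apply Subtype.ext
    change (ν.twist fun _ => T).tubeTrans i h S (u, 0) = (M u).1⁻¹ * ν.tubeTrans i h S (u, 0)
    rw [tubeTrans_twist_zero, twistMat_ofMatrix h e α hsm hdet]
    rfl
  rw [hval]
  have h1 : ((invMap _).comp M * ν.coreTrans i h S).Homotopic ((invMap _).comp M * M) :=
    homotopic_mul (ContinuousMap.Homotopic.refl _) hβ
  rw [inv_mul_self] at h1
  exact h1

end Choice

end FramedSphereFamily

end Literature.Topology.FourManifolds

end

/-! ## Part: `SurgeryOverlapTransition` -/

noncomputable section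

open scoped Manifold ContDiff Topology RealInnerProductSpace
open Set Function Bundle Metric Module

namespace Literature.Topology.FourManifolds

open StableFrames StableFrames.SurgerySwap

/-! ### Calculus on a product of model vector spaces with the product model -/

section ProdCalc

variable {E F G : Type*} [NormedAddCommGroup E] [NormedSpace ℝ E] [NormedAddCommGroup F]
  [NormedSpace ℝ F] [NormedAddCommGroup G] [NormedSpace ℝ G]

/-- `HasMFDerivAt` for the product model `𝓘(E) × 𝓘(F)` into a vector space is `HasFDerivAt`
(the extended charts are identities). [folklore] -/
theorem hasMFDerivAt_prodSelf_iff {f : E × F → G} {x : E × F} {f' : E × F →L[ℝ] G} :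
    HasMFDerivAt ((𝓘(ℝ, E)).prod 𝓘(ℝ, F)) 𝓘(ℝ, G) f x f' ↔ HasFDerivAt f f' x := by
  simp only [HasMFDerivAt, writtenInExtChartAt, extChartAt_prod, extChartAt_model_space_eq_id,
    PartialEquiv.refl_prod_refl, ModelWithCorners.range_prod, modelWithCornersSelf_coe, range_id,
    univ_prod_univ, hasFDerivWithinAt_univ, PartialEquiv.refl_coe, PartialEquiv.refl_symm,
    Function.comp_id, Function.id_comp, id_eq]
  exact ⟨fun h => h.2, fun h => ⟨h.continuousAt, h⟩⟩

/-- `HasMFDerivAt` between product models of vector spaces is `HasFDerivAt`. [folklore] -/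
theorem hasMFDerivAt_prodSelf_prodSelf_iff {E' F' : Type*} [NormedAddCommGroup E'] [NormedSpace ℝ E']
    [NormedAddCommGroup F'] [NormedSpace ℝ F'] {f : E × F → E' × F'} {x : E × F}
    {f' : E × F →L[ℝ] E' × F'} :
    HasMFDerivAt ((𝓘(ℝ, E)).prod 𝓘(ℝ, F)) ((𝓘(ℝ, E')).prod 𝓘(ℝ, F')) f x f' ↔ HasFDerivAt f f' x := by
  simp only [HasMFDerivAt, writtenInExtChartAt, extChartAt_prod, extChartAt_model_space_eq_id,
    PartialEquiv.refl_prod_refl, ModelWithCorners.range_prod, modelWithCornersSelf_coe, range_id,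
    univ_prod_univ, hasFDerivWithinAt_univ, PartialEquiv.refl_coe, PartialEquiv.refl_symm,
    Function.comp_id, Function.id_comp, id_eq]
  exact ⟨fun h => h.2, fun h => ⟨h.continuousAt, h⟩⟩

end ProdCalc

/-! ### The map `Θ(y, x) = (y, ‖y‖ x/‖x‖)` and its derivative -/

namespace SphereSurgery

attribute [local instance] fact_finrank_euclideanSpace_succ

variable {k l : ℕ}

/-- **Milnor's identification in cone coordinates**: `Θ(y, x) = (y, ‖y‖ • x/‖x‖)`, so that
`glue⁻¹ ∘ Ψ = φ̂ ∘ Θ` (`φ̂` the tube cone, `Ψ` the handle cone). [cite: MilnorHCobordism1965, Def. 3.11] -/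
def thetaMap (q : EuclideanSpace ℝ (Fin (k + 1)) × EuclideanSpace ℝ (Fin (l + 1))) :
    EuclideanSpace ℝ (Fin (k + 1)) × EuclideanSpace ℝ (Fin (l + 1)) :=
  (q.1, ‖q.1‖ • (radialProjection (spherePt l) q.2 : EuclideanSpace ℝ (Fin (l + 1))))

/-- The derivative of the norm at `θ • u` (`θ > 0`, `‖u‖ = 1`) is `⟪u, ·⟫`. [folklore] -/
theorem hasFDerivAt_norm_smul_unit {θ : ℝ} (hθ : 0 < θ) (u : Metric.sphere (0 : EuclideanSpace ℝ (Fin (k + 1))) 1) :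
    HasFDerivAt (fun y : EuclideanSpace ℝ (Fin (k + 1)) => ‖y‖)
      (innerSL ℝ (u : EuclideanSpace ℝ (Fin (k + 1)))) (θ • (u : EuclideanSpace ℝ (Fin (k + 1)))) := by
  have hu : ‖(u : EuclideanSpace ℝ (Fin (k + 1)))‖ = 1 := norm_eq_of_mem_sphere u
  have hn : ‖θ • (u : EuclideanSpace ℝ (Fin (k + 1)))‖ = θ := by
    rw [norm_smul, hu, mul_one, Real.norm_of_nonneg hθ.le]
  have h1 := (hasStrictFDerivAt_norm_sq (θ • (u : EuclideanSpace ℝ (Fin (k + 1))))).hasFDerivAt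
  have h2 := h1.sqrt (by rw [hn]; positivity)
  have heq : (fun y : EuclideanSpace ℝ (Fin (k + 1)) => √(‖y‖ ^ 2)) = fun y => ‖y‖ :=
    funext fun y => Real.sqrt_sq (norm_nonneg y)
  rw [heq] at h2
  refine h2.congr_fderiv (ContinuousLinearMap.ext fun y => ?_)
  rw [hn, Real.sqrt_sq hθ.le]
  simp only [smul_apply, innerSL_apply_apply, inner_smul_left, RCLike.conj_to_real,
    smul_eq_mul, nsmul_eq_mul, Nat.cast_ofNat]
  field_simp

/-- The derivative of `x ↦ x/‖x‖` at a unit vector `v` is the projection `ẋ ↦ ẋ - ⟪v, ẋ⟫ v`.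
[folklore] -/
theorem hasFDerivAt_coe_radialProjection (v : Metric.sphere (0 : EuclideanSpace ℝ (Fin (l + 1))) 1) :
    HasFDerivAt (fun x : EuclideanSpace ℝ (Fin (l + 1)) => (radialProjection (spherePt l) x : EuclideanSpace ℝ (Fin (l + 1))))
      (ContinuousLinearMap.id ℝ _ - (innerSL ℝ (v : EuclideanSpace ℝ (Fin (l + 1)))).smulRight
        (v : EuclideanSpace ℝ (Fin (l + 1)))) (v : EuclideanSpace ℝ (Fin (l + 1))) := by
  have hv0 : (v : EuclideanSpace ℝ (Fin (l + 1))) ≠ 0 := ne_zero_of_mem_unit_sphere v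
  have hv : ‖(v : EuclideanSpace ℝ (Fin (l + 1)))‖ = 1 := norm_eq_of_mem_sphere v
  -- near `v` the map is `x ↦ ‖x‖⁻¹ • x`
  have hev : (fun x : EuclideanSpace ℝ (Fin (l + 1)) =>
      (radialProjection (spherePt l) x : EuclideanSpace ℝ (Fin (l + 1)))) =ᶠ[𝓝 (v : EuclideanSpace ℝ (Fin (l + 1)))]
      fun x => ‖x‖⁻¹ • x := by
    filter_upwards [isOpen_ne.mem_nhds hv0] with x hx
    exact coe_radialProjection_of_ne_zero _ hx
  refine HasFDerivAt.congr_of_eventuallyEq ?_ hev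
  -- derivative of the norm at `v = 1 • v`, and of its inverse
  have hnorm : HasFDerivAt (fun x : EuclideanSpace ℝ (Fin (l + 1)) => ‖x‖)
      (innerSL ℝ (v : EuclideanSpace ℝ (Fin (l + 1)))) (v : EuclideanSpace ℝ (Fin (l + 1))) := by
    have := hasFDerivAt_norm_smul_unit (k := l) one_pos v
    rwa [one_smul] at this
  have hinv : HasFDerivAt (fun x : EuclideanSpace ℝ (Fin (l + 1)) => ‖x‖⁻¹)
      (-(innerSL ℝ (v : EuclideanSpace ℝ (Fin (l + 1))))) (v : EuclideanSpace ℝ (Fin (l + 1))) := by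
    have h1 := (hasFDerivAt_inv (𝕜 := ℝ) (x := ‖(v : EuclideanSpace ℝ (Fin (l + 1)))‖)
      (by rw [hv]; exact one_ne_zero)).comp (v : EuclideanSpace ℝ (Fin (l + 1))) hnorm
    refine h1.congr_fderiv (ContinuousLinearMap.ext fun x => ?_)
    simp [hv]
  have h := hinv.smul (hasFDerivAt_id (v : EuclideanSpace ℝ (Fin (l + 1))))
  refine h.congr_fderiv (ContinuousLinearMap.ext fun x => ?_)
  simp [hv, sub_eq_add_neg, neg_smul]

/-- **The derivative of `Θ` at `(θu, v)`** (`θ > 0`, `u`, `v` unit):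
`(ẏ, ẋ) ↦ (ẏ, ⟪u, ẏ⟫ • v + θ • (ẋ - ⟪v, ẋ⟫ • v))`, i.e. `KK (u, v) θ` followed by
`(a, b) ↦ (θ a, b)`. [folklore] -/
theorem hasFDerivAt_thetaMap {θ : ℝ} (hθ : 0 < θ) (u : Metric.sphere (0 : EuclideanSpace ℝ (Fin (k + 1))) 1)
    (v : Metric.sphere (0 : EuclideanSpace ℝ (Fin (l + 1))) 1) :
    HasFDerivAt (thetaMap (k := k) (l := l))
      ((ContinuousLinearMap.fst ℝ _ _).prod
        (θ • ((ContinuousLinearMap.id ℝ _ - (innerSL ℝ (v : EuclideanSpace ℝ (Fin (l + 1)))).smulRight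
            (v : EuclideanSpace ℝ (Fin (l + 1)))).comp (ContinuousLinearMap.snd ℝ _ _)) +
          ((innerSL ℝ (u : EuclideanSpace ℝ (Fin (k + 1)))).comp (ContinuousLinearMap.fst ℝ _ _)).smulRight
            (v : EuclideanSpace ℝ (Fin (l + 1)))))
      (θ • (u : EuclideanSpace ℝ (Fin (k + 1))), (v : EuclideanSpace ℝ (Fin (l + 1)))) := by
  have hu : ‖(u : EuclideanSpace ℝ (Fin (k + 1)))‖ = 1 := norm_eq_of_mem_sphere u
  have hn : ‖θ • (u : EuclideanSpace ℝ (Fin (k + 1)))‖ = θ := by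
    rw [norm_smul, hu, mul_one, Real.norm_of_nonneg hθ.le]
  -- the two factors of the second component
  have h1 : HasFDerivAt (fun q : EuclideanSpace ℝ (Fin (k + 1)) × EuclideanSpace ℝ (Fin (l + 1)) => ‖q.1‖)
      ((innerSL ℝ (u : EuclideanSpace ℝ (Fin (k + 1)))).comp (ContinuousLinearMap.fst ℝ _ _))
      (θ • (u : EuclideanSpace ℝ (Fin (k + 1))), (v : EuclideanSpace ℝ (Fin (l + 1)))) :=
    (hasFDerivAt_norm_smul_unit hθ u).comp
      ((θ • (u : EuclideanSpace ℝ (Fin (k + 1))), (v : EuclideanSpace ℝ (Fin (l + 1)))) :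
        EuclideanSpace ℝ (Fin (k + 1)) × EuclideanSpace ℝ (Fin (l + 1))) hasFDerivAt_fst
  have hs : HasFDerivAt (Prod.snd : EuclideanSpace ℝ (Fin (k + 1)) × EuclideanSpace ℝ (Fin (l + 1)) →
      EuclideanSpace ℝ (Fin (l + 1))) (ContinuousLinearMap.snd ℝ _ _)
      (θ • (u : EuclideanSpace ℝ (Fin (k + 1))), (v : EuclideanSpace ℝ (Fin (l + 1)))) := hasFDerivAt_snd
  have h2 : HasFDerivAt ((fun x : EuclideanSpace ℝ (Fin (l + 1)) =>
      (radialProjection (spherePt l) x : EuclideanSpace ℝ (Fin (l + 1)))) ∘ Prod.snd)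
      ((ContinuousLinearMap.id ℝ _ - (innerSL ℝ (v : EuclideanSpace ℝ (Fin (l + 1)))).smulRight
        (v : EuclideanSpace ℝ (Fin (l + 1)))).comp (ContinuousLinearMap.snd ℝ _ _))
      (θ • (u : EuclideanSpace ℝ (Fin (k + 1))), (v : EuclideanSpace ℝ (Fin (l + 1)))) := by
    have hg : HasFDerivAt (fun x : EuclideanSpace ℝ (Fin (l + 1)) =>
        (radialProjection (spherePt l) x : EuclideanSpace ℝ (Fin (l + 1))))
        (ContinuousLinearMap.id ℝ _ - (innerSL ℝ (v : EuclideanSpace ℝ (Fin (l + 1)))).smulRight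
          (v : EuclideanSpace ℝ (Fin (l + 1))))
        (Prod.snd ((θ • (u : EuclideanSpace ℝ (Fin (k + 1))), (v : EuclideanSpace ℝ (Fin (l + 1)))) :
          EuclideanSpace ℝ (Fin (k + 1)) × EuclideanSpace ℝ (Fin (l + 1)))) :=
      hasFDerivAt_coe_radialProjection v
    exact hg.comp _ hs
  have h12 := h1.smul h2
  have hsnd : HasFDerivAt (fun q : EuclideanSpace ℝ (Fin (k + 1)) × EuclideanSpace ℝ (Fin (l + 1)) =>
      ‖q.1‖ • (radialProjection (spherePt l) q.2 : EuclideanSpace ℝ (Fin (l + 1))))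
      (θ • ((ContinuousLinearMap.id ℝ _ - (innerSL ℝ (v : EuclideanSpace ℝ (Fin (l + 1)))).smulRight
            (v : EuclideanSpace ℝ (Fin (l + 1)))).comp (ContinuousLinearMap.snd ℝ _ _)) +
          ((innerSL ℝ (u : EuclideanSpace ℝ (Fin (k + 1)))).comp (ContinuousLinearMap.fst ℝ _ _)).smulRight
            (v : EuclideanSpace ℝ (Fin (l + 1))))
      (θ • (u : EuclideanSpace ℝ (Fin (k + 1))), (v : EuclideanSpace ℝ (Fin (l + 1)))) := by
    refine h12.congr_fderiv ?_
    change ‖θ • (u : EuclideanSpace ℝ (Fin (k + 1)))‖ • _ +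
      ContinuousLinearMap.smulRight _ (radialProjection (spherePt l) (v : EuclideanSpace ℝ (Fin (l + 1))) :
        EuclideanSpace ℝ (Fin (l + 1))) = _
    rw [hn, radialProjection_coe_sphere]
  exact hasFDerivAt_fst.prodMk hsnd

/-- Pointwise form: `dΘ_{(θu,v)} e = (e₁, ⟪u, e₁⟫ v + θ (e₂ - ⟪v, e₂⟫ v))`; in particular
`dΘ_{(θu,v)} e = ((θ • (KK e).1), (KK e).2)` for `KK = KK (u, v) θ`. [folklore] -/
theorem fderiv_thetaMap_apply {θ : ℝ} (hθ : 0 < θ) (u : Metric.sphere (0 : EuclideanSpace ℝ (Fin (k + 1))) 1)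
    (v : Metric.sphere (0 : EuclideanSpace ℝ (Fin (l + 1))) 1)
    (e : EuclideanSpace ℝ (Fin (k + 1)) × EuclideanSpace ℝ (Fin (l + 1))) :
    fderiv ℝ (thetaMap (k := k) (l := l)) (θ • (u : EuclideanSpace ℝ (Fin (k + 1))), (v : EuclideanSpace ℝ (Fin (l + 1)))) e =
      (e.1, ⟪(u : EuclideanSpace ℝ (Fin (k + 1))), e.1⟫ • (v : EuclideanSpace ℝ (Fin (l + 1))) +
        θ • (e.2 - ⟪(v : EuclideanSpace ℝ (Fin (l + 1))), e.2⟫ • (v : EuclideanSpace ℝ (Fin (l + 1))))) := by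
  rw [(hasFDerivAt_thetaMap hθ u v).fderiv]
  refine Prod.ext rfl ?_
  change θ • (e.2 - ⟪(v : EuclideanSpace ℝ (Fin (l + 1))), e.2⟫ • (v : EuclideanSpace ℝ (Fin (l + 1)))) +
    ⟪(u : EuclideanSpace ℝ (Fin (k + 1))), e.1⟫ • (v : EuclideanSpace ℝ (Fin (l + 1))) =
    ⟪(u : EuclideanSpace ℝ (Fin (k + 1))), e.1⟫ • (v : EuclideanSpace ℝ (Fin (l + 1))) +
      θ • (e.2 - ⟪(v : EuclideanSpace ℝ (Fin (l + 1))), e.2⟫ • (v : EuclideanSpace ℝ (Fin (l + 1))))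
  exact add_comm _ _

/-- `radialProjection` is invariant under positive scalings. [folklore] -/
theorem radialProjection_smul_of_pos {m : ℕ} (p : Metric.sphere (0 : EuclideanSpace ℝ (Fin (m + 1))) 1) {c : ℝ} (hc : 0 < c)
    (x : EuclideanSpace ℝ (Fin (m + 1))) : radialProjection p (c • x) = radialProjection p x := by
  by_cases hx : x = 0
  · subst hx; simp
  · have h1 : x = ‖x‖ • (radialProjection p x : EuclideanSpace ℝ (Fin (m + 1))) := by
      rw [coe_radialProjection_of_ne_zero p hx, smul_smul, mul_inv_cancel₀ (norm_ne_zero_iff.2 hx), one_smul]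
    conv_lhs => rw [h1, smul_smul]
    exact radialProjection_smul p (mul_pos hc (norm_pos_iff.2 hx)) _

/-- `Θ (θu, v) = (θu, θv)` for unit `u`, `v` and `θ > 0`. [folklore] -/
theorem thetaMap_smul_unit {θ : ℝ} (hθ : 0 < θ) (u : Metric.sphere (0 : EuclideanSpace ℝ (Fin (k + 1))) 1)
    (v : Metric.sphere (0 : EuclideanSpace ℝ (Fin (l + 1))) 1) :
    thetaMap (θ • (u : EuclideanSpace ℝ (Fin (k + 1))), (v : EuclideanSpace ℝ (Fin (l + 1)))) =
      (θ • (u : EuclideanSpace ℝ (Fin (k + 1))), θ • (v : EuclideanSpace ℝ (Fin (l + 1)))) := by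
  have hu : ‖(u : EuclideanSpace ℝ (Fin (k + 1)))‖ = 1 := norm_eq_of_mem_sphere u
  refine Prod.ext rfl ?_
  simp only [thetaMap, radialProjection_coe_sphere, norm_smul, hu, mul_one, Real.norm_of_nonneg hθ.le]

/-- The scaling `(a, b) ↦ (c • a, b)` of `ℝᵏ⁺¹ × ℝᵐ`. [folklore] -/
def scaleFst {m : ℕ} (c : ℝ) :
    (EuclideanSpace ℝ (Fin (k + 1)) × EuclideanSpace ℝ (Fin m)) →L[ℝ]
      (EuclideanSpace ℝ (Fin (k + 1)) × EuclideanSpace ℝ (Fin m)) :=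
  (c • ContinuousLinearMap.fst ℝ _ _).prod (ContinuousLinearMap.snd ℝ _ _)

/-- Values of `scaleFst`. [folklore] -/
@[simp] theorem scaleFst_apply {m : ℕ} (c : ℝ) (e : EuclideanSpace ℝ (Fin (k + 1)) × EuclideanSpace ℝ (Fin m)) :
    scaleFst c e = (c • e.1, e.2) := rfl

end SphereSurgery

/-! ### Radial invariance of the differential of the tube cone; the chain identity -/

namespace FramedSphereFamily

universe u

attribute [local instance] fact_finrank_euclideanSpace_succ

open SphereSurgery

section Radial

variable {EX HX : Type*} [NormedAddCommGroup EX] [NormedSpace ℝ EX] [TopologicalSpace HX]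
  {IX : ModelWithCorners ℝ EX HX} {X : Type u} [TopologicalSpace X] [ChartedSpace HX X]
  {ι : Type u} {k m : ℕ} (ν : FramedSphereFamily IX X ι k m) (i : ι)

/-- **Radial invariance of the differential of the cone**: `dφ̂_{(cu, w)} = dφ̂_{(u, w)} ∘ (c⁻¹ ⊕ 1)`
for `c > 0` (the cone is constant along rays). [folklore] -/
theorem mfderiv_cone_smul {c : ℝ} (hc : 0 < c) (u : Metric.sphere (0 : EuclideanSpace ℝ (Fin (k + 1))) 1)
    (w : EuclideanSpace ℝ (Fin m)) :
    mfderiv ((𝓘(ℝ, EuclideanSpace ℝ (Fin (k + 1)))).prod 𝓘(ℝ, EuclideanSpace ℝ (Fin m))) IX (ν.cone i)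
        (c • (u : EuclideanSpace ℝ (Fin (k + 1))), w) = (ν.coneDeriv i u w).comp (scaleFst c⁻¹) := by
  have hu0 : (u : EuclideanSpace ℝ (Fin (k + 1))) ≠ 0 := ne_zero_of_mem_unit_sphere u
  have hcu0 : c • (u : EuclideanSpace ℝ (Fin (k + 1))) ≠ 0 := smul_ne_zero hc.ne' hu0
  -- `cone ∘ scaleFst c = cone`
  have hfun : ν.cone i ∘ (scaleFst c : _ → EuclideanSpace ℝ (Fin (k + 1)) × EuclideanSpace ℝ (Fin m)) = ν.cone i := by
    funext q
    simp only [comp_apply, scaleFst_apply, cone, radialProjection_smul_of_pos _ hc]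
  have hS : HasMFDerivAt ((𝓘(ℝ, EuclideanSpace ℝ (Fin (k + 1)))).prod 𝓘(ℝ, EuclideanSpace ℝ (Fin m)))
      ((𝓘(ℝ, EuclideanSpace ℝ (Fin (k + 1)))).prod 𝓘(ℝ, EuclideanSpace ℝ (Fin m)))
      (scaleFst c : _ → EuclideanSpace ℝ (Fin (k + 1)) × EuclideanSpace ℝ (Fin m))
      ((u : EuclideanSpace ℝ (Fin (k + 1))), w) (scaleFst c) :=
    hasMFDerivAt_prodSelf_prodSelf_iff.2 (scaleFst c).hasFDerivAt
  have hd : MDifferentiableAt ((𝓘(ℝ, EuclideanSpace ℝ (Fin (k + 1)))).prod 𝓘(ℝ, EuclideanSpace ℝ (Fin m))) IX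
      (ν.cone i) (scaleFst c ((u : EuclideanSpace ℝ (Fin (k + 1))), w)) :=
    ν.mdifferentiableAt_cone i (q := scaleFst c ((u : EuclideanSpace ℝ (Fin (k + 1))), w)) hcu0
  have hchain := mfderiv_comp ((u : EuclideanSpace ℝ (Fin (k + 1))), w) hd hS.mdifferentiableAt
  rw [hfun, hS.mfderiv] at hchain
  -- `coneDeriv u w = dφ̂_{(cu,w)} ∘ scaleFst c`; evaluate at `scaleFst c⁻¹ e`
  refine ContinuousLinearMap.ext fun e => ?_
  have h1 := DFunLike.congr_fun hchain (scaleFst c⁻¹ e)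
  have h2 : scaleFst c (scaleFst c⁻¹ e) = e := by
    rw [scaleFst_apply, scaleFst_apply]
    exact Prod.ext (by simp [smul_smul, mul_inv_cancel₀ hc.ne']) rfl
  have h3 : ((mfderiv ((𝓘(ℝ, EuclideanSpace ℝ (Fin (k + 1)))).prod 𝓘(ℝ, EuclideanSpace ℝ (Fin m))) IX (ν.cone i)
      (scaleFst c ((u : EuclideanSpace ℝ (Fin (k + 1))), w))).comp (scaleFst c)) (scaleFst c⁻¹ e) =
      mfderiv ((𝓘(ℝ, EuclideanSpace ℝ (Fin (k + 1)))).prod 𝓘(ℝ, EuclideanSpace ℝ (Fin m))) IX (ν.cone i)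
        (c • (u : EuclideanSpace ℝ (Fin (k + 1))), w) e := by
    change mfderiv ((𝓘(ℝ, EuclideanSpace ℝ (Fin (k + 1)))).prod 𝓘(ℝ, EuclideanSpace ℝ (Fin m))) IX (ν.cone i)
      (scaleFst c ((u : EuclideanSpace ℝ (Fin (k + 1))), w)) (scaleFst c (scaleFst c⁻¹ e)) = _
    rw [h2]
    rfl
  exact (h1.trans h3).symm

end Radial

section Chain

variable {n k l : ℕ} {X : Type u} [TopologicalSpace X] [T2Space X] [ChartedSpace (EuclideanHalfSpace (n + 1)) X]
  {ι : Type u} [Finite ι] [Nonempty ι]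
  (ν : FramedSphereFamily (𝓡∂ (n + 1)) X ι k (l + 1)) (i : ι) (hkl : k + l = n)

/-- **`glue⁻¹ ∘ Ψ = φ̂ ∘ Θ`**: on `0 < ‖y‖ < 1` the inverse gluing map reads, in the handle cone
and the tube cone, as Milnor's `Θ(y, x) = (y, ‖y‖ x/‖x‖)`. [cite: MilnorHCobordism1965, Def. 3.11] -/
theorem coe_glue_symm_handleCone {q : EuclideanSpace ℝ (Fin (k + 1)) × EuclideanSpace ℝ (Fin (l + 1))}
    (hq : ‖q.1‖ < 1) (hq0 : q.1 ≠ 0) :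
    (((ν.glue hkl).symm (handleCone hkl i q) : ↥ν.complement) : X) = ν.cone i (thetaMap q) := by
  rw [glue_symm_apply, ofHandle_handleCone hkl i hq, coe_bwdA_apply]
  · rw [Equiv.symm_apply_apply]
    rfl
  · exact hq0

/-- **The chain identity on the overlap**:
`d(glue⁻¹)_{Ψ(θu,v)} ∘ dΨ_{(θu,v)} = dφ̂_{(u,θv)} ∘ KK (u, v) θ` for `0 < θ < 1`
(`SurgerySwapMatrix`: "`L ∘ KK u v θ` is the differential of `(y, x) ↦ φ(y/‖y‖, ‖y‖ x/‖x‖)` at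
`(θu, v)`"). [cite: KervaireMilnorAnnals1963, §6 p. 521] -/
theorem mfderiv_glue_symm_comp_handleDeriv {θ : ℝ} (hθ : 0 < θ) (hθ1 : θ < 1)
    (u : Metric.sphere (0 : EuclideanSpace ℝ (Fin (k + 1))) 1) (v : Metric.sphere (0 : EuclideanSpace ℝ (Fin (l + 1))) 1) :
    (mfderiv (𝓡∂ (n + 1)) (𝓡∂ (n + 1)) (ν.glue hkl).symm
        (handleChart hkl i (θ • (u : EuclideanSpace ℝ (Fin (k + 1))), v))).comp
        (handleDeriv hkl i (θ • (u : EuclideanSpace ℝ (Fin (k + 1)))) v) =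
      (ν.coneDeriv i u (θ • (v : EuclideanSpace ℝ (Fin (l + 1))))).comp (KK ((u : EuclideanSpace ℝ (Fin (k + 1))),
        (v : EuclideanSpace ℝ (Fin (l + 1)))) θ).toContinuousLinearMap := by
  have hu : ‖(u : EuclideanSpace ℝ (Fin (k + 1)))‖ = 1 := norm_eq_of_mem_sphere u
  have hu0 : (u : EuclideanSpace ℝ (Fin (k + 1))) ≠ 0 := ne_zero_of_mem_unit_sphere u
  have hv0 : (v : EuclideanSpace ℝ (Fin (l + 1))) ≠ 0 := ne_zero_of_mem_unit_sphere v
  have hθu : ‖θ • (u : EuclideanSpace ℝ (Fin (k + 1)))‖ < 1 := by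
    rw [norm_smul, hu, mul_one, Real.norm_of_nonneg hθ.le]; exact hθ1
  have hθu0 : θ • (u : EuclideanSpace ℝ (Fin (k + 1))) ≠ 0 := smul_ne_zero hθ.ne' hu0
  set q₀ : EuclideanSpace ℝ (Fin (k + 1)) × EuclideanSpace ℝ (Fin (l + 1)) :=
    (θ • (u : EuclideanSpace ℝ (Fin (k + 1))), (v : EuclideanSpace ℝ (Fin (l + 1)))) with hq₀
  have hθu' : ‖q₀.1‖ < 1 := hθu
  have hθu0' : q₀.1 ≠ 0 := hθu0
  show (mfderiv (𝓡∂ (n + 1)) (𝓡∂ (n + 1)) (ν.glue hkl).symm (handleCone hkl i q₀)).comp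
      (mfderiv ((𝓘(ℝ, EuclideanSpace ℝ (Fin (k + 1)))).prod 𝓘(ℝ, EuclideanSpace ℝ (Fin (l + 1)))) (𝓡∂ (n + 1))
        (handleCone hkl i) q₀) = _
  -- ### the composite `val ∘ glue⁻¹ ∘ Ψ` agrees with `cone ∘ Θ` near `q₀`
  have hO : IsOpen {q : EuclideanSpace ℝ (Fin (k + 1)) × EuclideanSpace ℝ (Fin (l + 1)) |
      ‖q.1‖ < 1 ∧ q.1 ≠ 0} :=
    (isOpen_lt (continuous_norm.comp continuous_fst) continuous_const).inter
      (isOpen_ne.preimage continuous_fst)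
  have hev : (fun q => ((((ν.glue hkl).symm (handleCone hkl i q)) : ↥ν.complement) : X)) =ᶠ[𝓝 q₀]
      (ν.cone i ∘ thetaMap) := by
    filter_upwards [hO.mem_nhds (show q₀ ∈ _ from ⟨hθu, hθu0⟩)] with q hq
    exact ν.coe_glue_symm_handleCone i hkl hq.1 hq.2
  -- ### differentiability of the three maps
  have hΨ : MDifferentiableAt ((𝓘(ℝ, EuclideanSpace ℝ (Fin (k + 1)))).prod 𝓘(ℝ, EuclideanSpace ℝ (Fin (l + 1))))
      (𝓡∂ (n + 1)) (handleCone hkl i) q₀ := mdifferentiableAt_handleCone hkl i (q := q₀) ⟨hθu', hv0⟩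
  have hb : handleCone hkl i q₀ ∈ (ν.glue hkl).target := by
    have h1 := ofHandle_handleCone hkl i (q := q₀) hθu'
    change ((ofHandle ι k l hkl (handleCone hkl i q₀) : ↥(ballTimesSphere ι k l)) :
      DiscreteIndex ι × (EuclideanSpace ℝ (Fin (k + 1)) × Metric.sphere (0 : EuclideanSpace ℝ (Fin (l + 1))) 1)).2.1 ≠ 0
    rw [h1]
    exact hθu0'
  have hG : MDifferentiableAt (𝓡∂ (n + 1)) (𝓡∂ (n + 1)) (ν.glue hkl).symm (handleCone hkl i q₀) :=
    ((ν.contMDiffOn_glue_symm hkl).mdifferentiableOn (by simp) _ hb).mdifferentiableAt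
      ((ν.glue hkl).open_target.mem_nhds hb)
  have hval := Literature.Geometry.Manifold.OpenSubmanifold.hasMFDerivAt_subtype_val (I := 𝓡∂ (n + 1))
    (U := ν.complement) ((ν.glue hkl).symm (handleCone hkl i q₀))
  -- ### the left-hand side as the differential of the composite
  have hL : mfderiv ((𝓘(ℝ, EuclideanSpace ℝ (Fin (k + 1)))).prod 𝓘(ℝ, EuclideanSpace ℝ (Fin (l + 1)))) (𝓡∂ (n + 1))
      (fun q => ((((ν.glue hkl).symm (handleCone hkl i q)) : ↥ν.complement) : X)) q₀ =
      (mfderiv (𝓡∂ (n + 1)) (𝓡∂ (n + 1)) (ν.glue hkl).symm (handleCone hkl i q₀)).comp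
        (mfderiv ((𝓘(ℝ, EuclideanSpace ℝ (Fin (k + 1)))).prod 𝓘(ℝ, EuclideanSpace ℝ (Fin (l + 1)))) (𝓡∂ (n + 1))
          (handleCone hkl i) q₀) := by
    have h1 := mfderiv_comp q₀ hG hΨ
    have hval' : HasMFDerivAt (𝓡∂ (n + 1)) (𝓡∂ (n + 1)) (Subtype.val : ↥ν.complement → X)
        (((ν.glue hkl).symm ∘ handleCone hkl i) q₀) (ContinuousLinearMap.id ℝ _) := hval
    have h2 := mfderiv_comp q₀ hval'.mdifferentiableAt (hG.comp q₀ hΨ)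
    rw [hval'.mfderiv] at h2
    rw [show (fun q => ((((ν.glue hkl).symm (handleCone hkl i q)) : ↥ν.complement) : X)) =
      Subtype.val ∘ ((ν.glue hkl).symm ∘ handleCone hkl i) from rfl, h2, h1]
    rfl
  -- ### the right-hand side as the differential of `cone ∘ Θ`
  have hΘ : HasMFDerivAt ((𝓘(ℝ, EuclideanSpace ℝ (Fin (k + 1)))).prod 𝓘(ℝ, EuclideanSpace ℝ (Fin (l + 1))))
      ((𝓘(ℝ, EuclideanSpace ℝ (Fin (k + 1)))).prod 𝓘(ℝ, EuclideanSpace ℝ (Fin (l + 1)))) thetaMap q₀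
      (fderiv ℝ thetaMap q₀) :=
    hasMFDerivAt_prodSelf_prodSelf_iff.2 (hasFDerivAt_thetaMap hθ u v).differentiableAt.hasFDerivAt
  have hΘq : thetaMap q₀ = (θ • (u : EuclideanSpace ℝ (Fin (k + 1))), θ • (v : EuclideanSpace ℝ (Fin (l + 1)))) :=
    thetaMap_smul_unit hθ u v
  have hcone : MDifferentiableAt ((𝓘(ℝ, EuclideanSpace ℝ (Fin (k + 1)))).prod 𝓘(ℝ, EuclideanSpace ℝ (Fin (l + 1))))
      (𝓡∂ (n + 1)) (ν.cone i) (thetaMap q₀) := by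
    rw [hΘq]
    exact ν.mdifferentiableAt_cone i
      (q := (θ • (u : EuclideanSpace ℝ (Fin (k + 1))), θ • (v : EuclideanSpace ℝ (Fin (l + 1))))) hθu0
  have hR : mfderiv ((𝓘(ℝ, EuclideanSpace ℝ (Fin (k + 1)))).prod 𝓘(ℝ, EuclideanSpace ℝ (Fin (l + 1)))) (𝓡∂ (n + 1))
      (ν.cone i ∘ thetaMap) q₀ =
      ((ν.coneDeriv i u (θ • (v : EuclideanSpace ℝ (Fin (l + 1))))).comp (scaleFst θ⁻¹)).comp
        (fderiv ℝ thetaMap q₀) := by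
    rw [mfderiv_comp q₀ hcone hΘ.mdifferentiableAt, hΘ.mfderiv]
    congr 1
    rw [show mfderiv ((𝓘(ℝ, EuclideanSpace ℝ (Fin (k + 1)))).prod 𝓘(ℝ, EuclideanSpace ℝ (Fin (l + 1))))
      (𝓡∂ (n + 1)) (ν.cone i) (thetaMap q₀) = mfderiv ((𝓘(ℝ, EuclideanSpace ℝ (Fin (k + 1)))).prod
        𝓘(ℝ, EuclideanSpace ℝ (Fin (l + 1)))) (𝓡∂ (n + 1)) (ν.cone i)
          (θ • (u : EuclideanSpace ℝ (Fin (k + 1))), θ • (v : EuclideanSpace ℝ (Fin (l + 1)))) by rw [hΘq]]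
    exact ν.mfderiv_cone_smul i hθ u _
  -- ### assemble
  rw [← hL, hev.mfderiv_eq, hR]
  refine ContinuousLinearMap.ext fun e => ?_
  change ν.coneDeriv i u (θ • (v : EuclideanSpace ℝ (Fin (l + 1)))) (scaleFst θ⁻¹ (fderiv ℝ thetaMap q₀ e)) =
    ν.coneDeriv i u (θ • (v : EuclideanSpace ℝ (Fin (l + 1)))) (KK ((u : EuclideanSpace ℝ (Fin (k + 1))),
      (v : EuclideanSpace ℝ (Fin (l + 1)))) θ e)
  congr 1
  rw [hq₀, fderiv_thetaMap_apply hθ u v e, scaleFst_apply, KK_apply]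

end Chain

end FramedSphereFamily

end Literature.Topology.FourManifolds

end

/-! ## Part: `SurgeryOverlapComparison` -/

noncomputable section

open scoped Manifold ContDiff Topology RealInnerProductSpace
open Set Function Bundle Metric Module

namespace Literature.Topology.FourManifolds

open StableFrames StableFrames.SurgerySwap SphereSurgery

/-! ### The cylinder frames only see one component of the base point -/

namespace StableFrames.SurgerySwap

attribute [local instance] fact_finrank_euclideanSpace_succ

/-- `cylR p` depends on `p` only through `p.2`. [folklore] -/
theorem cylR_eq_of_snd_eq {k m N' : ℕ} {p p' : EuclideanSpace ℝ (Fin (k + 1)) × EuclideanSpace ℝ (Fin m)}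
    (hp : p.2 = p'.2) (h : k + 1 + m = N' + 1)
    (L' : (EuclideanSpace ℝ (Fin (k + 1)) × EuclideanSpace ℝ (Fin m)) →ₗ[ℝ] EuclideanSpace ℝ (Fin N')) :
    cylR p h L' = cylR p' h L' := by
  obtain ⟨a, b⟩ := p
  obtain ⟨a', b'⟩ := p'
  cases hp
  rfl

/-- `cylT p` depends on `p` only through `p.1`. [folklore] -/
theorem cylT_eq_of_fst_eq {k m N' : ℕ} {p p' : EuclideanSpace ℝ (Fin (k + 1)) × EuclideanSpace ℝ (Fin m)}
    (hp : p.1 = p'.1) (h : k + 1 + m = N' + 1)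
    (L : (EuclideanSpace ℝ (Fin (k + 1)) × EuclideanSpace ℝ (Fin m)) →ₗ[ℝ] EuclideanSpace ℝ (Fin N')) :
    cylT p h L = cylT p' h L := by
  obtain ⟨a, b⟩ := p
  obtain ⟨a', b'⟩ := p'
  cases hp
  rfl

end StableFrames.SurgerySwap

namespace FramedSphereFamily

universe u

attribute [local instance] fact_finrank_euclideanSpace_succ

variable {n k l : ℕ} {X : Type u} [TopologicalSpace X] [T2Space X] [ChartedSpace (EuclideanHalfSpace (n + 1)) X]
  [IsManifold (𝓡∂ (n + 1)) ∞ X] {ι : Type u} [Finite ι] [Nonempty ι]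
  (ν : FramedSphereFamily (𝓡∂ (n + 1)) X ι k (l + 1)) (i : ι) (hkl : k + l = n)
  (h : k + 1 + (l + 1) = n + 1 + 1) (S : SFrame n X)

omit [IsManifold (𝓡∂ (n + 1)) ∞ X] in
/-- The gluing map is differentiable with differentiable inverse. [folklore] -/
theorem glueMDifferentiable : (ν.glue hkl).MDifferentiable (𝓡∂ (n + 1)) (𝓡∂ (n + 1)) :=
  ⟨(ν.contMDiffOn_glue hkl).mdifferentiableOn (by simp), (ν.contMDiffOn_glue_symm hkl).mdifferentiableOn (by simp)⟩

/-- **The framing of `X` transported to the handle by the gluing map**: at `b ∈ glue.target`,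
`(d(glue)_{glue⁻¹ b} (sⱼ), real part)`. [cite: KervaireMilnorAnnals1963, §6 p. 521] -/
def strFrame (b : Handle ι k l hkl) : Fr (n + 1) := fun j =>
  (mfderiv (𝓡∂ (n + 1)) (𝓡∂ (n + 1)) (ν.glue hkl) ((ν.glue hkl).symm b)
      (S.s j (((ν.glue hkl).symm b : ↥ν.complement) : X)).1,
    (S.s j (((ν.glue hkl).symm b : ↥ν.complement) : X)).2)

/-- The transport as a linear automorphism of `ℝⁿ⁺¹ × ℝ`. [folklore] -/
def strEquiv {b : Handle ι k l hkl} (hb : b ∈ (ν.glue hkl).target) :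
    (EuclideanSpace ℝ (Fin (n + 1)) × ℝ) ≃ₗ[ℝ] (EuclideanSpace ℝ (Fin (n + 1)) × ℝ) :=
  ((ν.glueMDifferentiable hkl).mfderiv ((ν.glue hkl).map_target hb)).toLinearEquiv.prodCongr
    (LinearEquiv.refl ℝ ℝ)

omit [IsManifold (𝓡∂ (n + 1)) ∞ X] in
/-- Values of the transport. [folklore] -/
theorem strEquiv_apply {b : Handle ι k l hkl} (hb : b ∈ (ν.glue hkl).target) (w : EuclideanSpace ℝ (Fin (n + 1)) × ℝ) :
    ν.strEquiv hkl hb w = (mfderiv (𝓡∂ (n + 1)) (𝓡∂ (n + 1)) (ν.glue hkl) ((ν.glue hkl).symm b) w.1, w.2) := rfl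

/-- `strFrame b = strEquiv ∘ (S at glue⁻¹ b)`. [folklore] -/
theorem strFrame_eq {b : Handle ι k l hkl} (hb : b ∈ (ν.glue hkl).target) :
    ν.strFrame hkl S b = (ν.strEquiv hkl hb) ∘ frameAt S (((ν.glue hkl).symm b : ↥ν.complement) : X) := by
  funext j
  rfl

/-- **The transported framing is a stable frame field on `glue.target`.** [folklore] -/
theorem isFrameFieldAlong_strFrame :
    IsFrameFieldAlong (𝓡∂ (n + 1)) id (ν.strFrame hkl S) (ν.glue hkl).target := by
  refine ⟨fun j => ?_, fun j => ?_, fun b hb => ?_⟩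
  · -- push the field `a ↦ sⱼ(a)` of `T(X ∖ S)` along `glue`, precomposed with `glue⁻¹`
    have hFA := (S.restrict ν.complement).cont j
    have hv : ContinuousOn (fun b : Handle ι k l hkl =>
        (TotalSpace.mk' (EuclideanSpace ℝ (Fin (n + 1))) ((ν.glue hkl).symm b)
          (S.s j (((ν.glue hkl).symm b : ↥ν.complement) : X)).1 : TangentBundle (𝓡∂ (n + 1)) ↥ν.complement))
        (ν.glue hkl).target :=
      hFA.comp_continuousOn (ν.glue hkl).continuousOn_symm
    have hpush := ContinuousOn.totalSpaceMk_mfderiv (I := 𝓡∂ (n + 1)) (J := 𝓡∂ (n + 1))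
      (f := ν.glue hkl) (ν.glue hkl).open_source
      ((ν.contMDiffOn_glue hkl).of_le (by exact_mod_cast le_top)) hv (ν.glue hkl).mapsTo_symm
    refine hpush.congr fun b hb => ?_
    change (TotalSpace.mk' _ b _ : TangentBundle (𝓡∂ (n + 1)) (Handle ι k l hkl)) =
      TotalSpace.mk' _ ((ν.glue hkl) ((ν.glue hkl).symm b)) _
    rw [(ν.glue hkl).right_inv hb]
    rfl
  · exact (S.cont₂ j).comp_continuousOn (continuous_subtype_val.comp_continuousOn (ν.glue hkl).continuousOn_symm)
  · rw [strFrame_eq ν hkl S hb]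
    exact (S.linearIndependent _).map' (ν.strEquiv hkl hb).toLinearMap (ν.strEquiv hkl hb).ker

/-- **The overlap comparison matrix** in the coordinates of the handle chart:
`compMat (strFrame (Ψ₀ q)) (handleCyl q)`. [cite: KervaireMilnorAnnals1963, §6 p. 521] -/
def overlapTrans (q : EuclideanSpace ℝ (Fin (k + 1)) × Metric.sphere (0 : EuclideanSpace ℝ (Fin (l + 1))) 1) :
    Matrix (Fin (n + 1 + 1)) (Fin (n + 1 + 1)) ℝ :=
  compMat (ν.strFrame hkl S (handleChart hkl i q)) (handleCyl hkl i h q)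

omit [IsManifold (𝓡∂ (n + 1)) ∞ X] in
/-- The handle chart maps `0 < ‖y‖ < 1` into `glue.target`. [folklore] -/
theorem handleChart_mem_target {q : EuclideanSpace ℝ (Fin (k + 1)) × Metric.sphere (0 : EuclideanSpace ℝ (Fin (l + 1))) 1}
    (hq : ‖q.1‖ < 1) (hq0 : q.1 ≠ 0) : handleChart hkl i q ∈ (ν.glue hkl).target := by
  have h1 := ofHandle_handleCone hkl i (q := hypR q) hq
  change ((ofHandle ι k l hkl (handleCone hkl i (hypR q)) : ↥(ballTimesSphere ι k l)) :
    DiscreteIndex ι × (EuclideanSpace ℝ (Fin (k + 1)) × Metric.sphere (0 : EuclideanSpace ℝ (Fin (l + 1))) 1)).2.1 ≠ 0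
  rw [h1]
  exact hq0

/-- **The overlap comparison matrix is continuous on `0 < ‖y‖ < 1`.** [folklore] -/
theorem continuousOn_overlapTrans :
    ContinuousOn (ν.overlapTrans i hkl h S) {q | ‖q.1‖ < 1 ∧ q.1 ≠ 0} := by
  have hc : ContinuousOn (handleChart hkl i) {q : EuclideanSpace ℝ (Fin (k + 1)) ×
      Metric.sphere (0 : EuclideanSpace ℝ (Fin (l + 1))) 1 | ‖q.1‖ < 1 ∧ q.1 ≠ 0} :=
    fun q hq => (contMDiffAt_handleChart hkl i hq.1).continuousAt.continuousWithinAt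
  have h1 : IsFrameFieldAlong (𝓡∂ (n + 1)) (id ∘ handleChart hkl i) (ν.strFrame hkl S ∘ handleChart hkl i)
      {q | ‖q.1‖ < 1 ∧ q.1 ≠ 0} :=
    (ν.isFrameFieldAlong_strFrame hkl S).comp hc fun q hq => ν.handleChart_mem_target i hkl hq.1 hq.2
  have h2 := (isFrameFieldAlong_handleCyl hkl i h (ι := ι)).mono
    (show {q : EuclideanSpace ℝ (Fin (k + 1)) × Metric.sphere (0 : EuclideanSpace ℝ (Fin (l + 1))) 1 |
      ‖q.1‖ < 1 ∧ q.1 ≠ 0} ⊆ {q | ‖q.1‖ < 1} from fun q hq => hq.1)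
  exact h1.continuousOn_compMat h2

/-- The overlap comparison matrix is invertible on `0 < ‖y‖ < 1`. [folklore] -/
theorem det_overlapTrans_ne_zero {q : EuclideanSpace ℝ (Fin (k + 1)) × Metric.sphere (0 : EuclideanSpace ℝ (Fin (l + 1))) 1}
    (hq : ‖q.1‖ < 1) (hq0 : q.1 ≠ 0) : (ν.overlapTrans i hkl h S q).det ≠ 0 :=
  det_compMat_ne_zero ((ν.isFrameFieldAlong_strFrame hkl S).2.2 _ (ν.handleChart_mem_target i hkl hq hq0))
    (linearIndependent_handleCyl hkl i h hq)

/-- The transported framing is the handle cylinder frame acted on by the overlap matrix.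
[folklore] -/
theorem act_handleCyl_overlapTrans {q : EuclideanSpace ℝ (Fin (k + 1)) × Metric.sphere (0 : EuclideanSpace ℝ (Fin (l + 1))) 1}
    (hq : ‖q.1‖ < 1) :
    act (handleCyl hkl i h q) (ν.overlapTrans i hkl h S q) = ν.strFrame hkl S (handleChart hkl i q) :=
  act_compMat (linearIndependent_handleCyl hkl i h hq)

/-- **The overlap comparison matrix in cone coordinates**: for `0 < θ < 1`,
`overlapTrans (θu, v) = (Xmat (u, v) θ)⁻¹ · tubeTrans (u, θ • v)` — the transported framing
read in the handle cylinder frame is the tube transition twisted by the universal swap matrix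
(Kervaire–Milnor 1963, §6; Kosinski X.(2.1)). [cite: KervaireMilnorAnnals1963, §6 p. 521] -/
theorem overlapTrans_eq {θ : ℝ} (hθ : 0 < θ) (hθ1 : θ < 1)
    (u : Metric.sphere (0 : EuclideanSpace ℝ (Fin (k + 1))) 1) (v : Metric.sphere (0 : EuclideanSpace ℝ (Fin (l + 1))) 1) :
    ν.overlapTrans i hkl h S (θ • (u : EuclideanSpace ℝ (Fin (k + 1))), v) =
      (Xmat ((u : EuclideanSpace ℝ (Fin (k + 1))), (v : EuclideanSpace ℝ (Fin (l + 1)))) h θ)⁻¹ *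
        ν.tubeTrans i h S (u, θ • (v : EuclideanSpace ℝ (Fin (l + 1)))) := by
  have hu : ‖(u : EuclideanSpace ℝ (Fin (k + 1)))‖ = 1 := norm_eq_of_mem_sphere u
  have hvn : ‖(v : EuclideanSpace ℝ (Fin (l + 1)))‖ = 1 := norm_eq_of_mem_sphere v
  have hu0 : (u : EuclideanSpace ℝ (Fin (k + 1))) ≠ 0 := ne_zero_of_mem_unit_sphere u
  have hθu : ‖θ • (u : EuclideanSpace ℝ (Fin (k + 1)))‖ < 1 := by
    rw [norm_smul, hu, mul_one, Real.norm_of_nonneg hθ.le]; exact hθ1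
  have hθu0 : θ • (u : EuclideanSpace ℝ (Fin (k + 1))) ≠ 0 := smul_ne_zero hθ.ne' hu0
  set q : EuclideanSpace ℝ (Fin (k + 1)) × Metric.sphere (0 : EuclideanSpace ℝ (Fin (l + 1))) 1 :=
    (θ • (u : EuclideanSpace ℝ (Fin (k + 1))), v) with hqdef
  have hq : ‖q.1‖ < 1 := hθu
  have hq0 : q.1 ≠ 0 := hθu0
  have hb : handleChart hkl i q ∈ (ν.glue hkl).target := ν.handleChart_mem_target i hkl hq hq0
  -- the common point `x = glue⁻¹ (Ψ₀ q) = φ (u, θ v)`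
  have hx : (((ν.glue hkl).symm (handleChart hkl i q) : ↥ν.complement) : X) =
      ν.toFun i (u, θ • (v : EuclideanSpace ℝ (Fin (l + 1)))) := by
    have h1 := ν.coe_glue_symm_handleCone i hkl (q := hypR q) hq hq0
    have h2 : thetaMap (hypR q) = (θ • (u : EuclideanSpace ℝ (Fin (k + 1))), θ • (v : EuclideanSpace ℝ (Fin (l + 1)))) :=
      thetaMap_smul_unit hθ u v
    rw [handleChart, h1, h2]
    exact ν.cone_smul i hθ u _
  -- ### the handle cylinder frame pulled back by the transport `d(glue)`
  have hDD' : ∀ w, mfderiv (𝓡∂ (n + 1)) (𝓡∂ (n + 1)) (ν.glue hkl) ((ν.glue hkl).symm (handleChart hkl i q))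
      (mfderiv (𝓡∂ (n + 1)) (𝓡∂ (n + 1)) (ν.glue hkl).symm (handleChart hkl i q) w) = w :=
    fun w => DFunLike.congr_fun ((ν.glueMDifferentiable hkl).comp_symm_deriv hb) w
  have hcyl : handleCyl hkl i h q = (ν.strEquiv hkl hb) ∘
      cylR (hypR q) h ((mfderiv (𝓡∂ (n + 1)) (𝓡∂ (n + 1)) (ν.glue hkl).symm (handleChart hkl i q)).comp
        (handleDeriv hkl i q.1 q.2)).toLinearMap := by
    funext j
    rw [comp_apply, strEquiv_apply]
    exact Prod.ext (hDD' _).symm rfl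
  -- ### the chain identity and the swap
  have hchain : ((mfderiv (𝓡∂ (n + 1)) (𝓡∂ (n + 1)) (ν.glue hkl).symm (handleChart hkl i q)).comp
      (handleDeriv hkl i q.1 q.2)).toLinearMap =
      (ν.coneDeriv i u (θ • (v : EuclideanSpace ℝ (Fin (l + 1))))).toLinearMap.comp
        (KK ((u : EuclideanSpace ℝ (Fin (k + 1))), (v : EuclideanSpace ℝ (Fin (l + 1)))) θ) :=
    congrArg ContinuousLinearMap.toLinearMap (ν.mfderiv_glue_symm_comp_handleDeriv i hkl hθ hθ1 u v)
  have hL : (ν.coneDeriv i u (θ • (v : EuclideanSpace ℝ (Fin (l + 1))))).toLinearMap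
      (nT ((u : EuclideanSpace ℝ (Fin (k + 1))), (v : EuclideanSpace ℝ (Fin (l + 1))))) = 0 :=
    ν.coneDeriv_apply_normal i u _
  have hCeq : cylR (hypR q) h ((mfderiv (𝓡∂ (n + 1)) (𝓡∂ (n + 1)) (ν.glue hkl).symm (handleChart hkl i q)).comp
        (handleDeriv hkl i q.1 q.2)).toLinearMap =
      act (ν.tubeCyl i h (u, θ • (v : EuclideanSpace ℝ (Fin (l + 1)))))
        (Xmat ((u : EuclideanSpace ℝ (Fin (k + 1))), (v : EuclideanSpace ℝ (Fin (l + 1)))) h θ) := by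
    have e1 : (hypR q).2 = (((u : EuclideanSpace ℝ (Fin (k + 1))), (v : EuclideanSpace ℝ (Fin (l + 1)))) :
        EuclideanSpace ℝ (Fin (k + 1)) × EuclideanSpace ℝ (Fin (l + 1))).2 := rfl
    have e2 : (((u : EuclideanSpace ℝ (Fin (k + 1))), (v : EuclideanSpace ℝ (Fin (l + 1)))) :
        EuclideanSpace ℝ (Fin (k + 1)) × EuclideanSpace ℝ (Fin (l + 1))).1 =
          (hyp (u, θ • (v : EuclideanSpace ℝ (Fin (l + 1))))).1 := rfl
    have e3 := cylR_eq_act (p := ((u : EuclideanSpace ℝ (Fin (k + 1))), (v : EuclideanSpace ℝ (Fin (l + 1)))))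
      hu hvn h (θ := θ) (L := (ν.coneDeriv i u (θ • (v : EuclideanSpace ℝ (Fin (l + 1))))).toLinearMap) hL
    rw [hchain, cylR_eq_of_snd_eq e1 h, e3, cylT_eq_of_fst_eq e2 h]
    rfl
  have hTi : LinearIndependent ℝ (ν.tubeCyl i h (u, θ • (v : EuclideanSpace ℝ (Fin (l + 1))))) :=
    ν.linearIndependent_tubeCyl i h (u, θ • (v : EuclideanSpace ℝ (Fin (l + 1))))
  have hXd : (Xmat ((u : EuclideanSpace ℝ (Fin (k + 1))), (v : EuclideanSpace ℝ (Fin (l + 1)))) h θ).det ≠ 0 :=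
    det_Xmat_ne_zero (p := ((u : EuclideanSpace ℝ (Fin (k + 1))), (v : EuclideanSpace ℝ (Fin (l + 1))))) hu hvn h hθ.ne'
  have hCi : LinearIndependent ℝ (cylR (hypR q) h ((mfderiv (𝓡∂ (n + 1)) (𝓡∂ (n + 1)) (ν.glue hkl).symm
      (handleChart hkl i q)).comp (handleDeriv hkl i q.1 q.2)).toLinearMap) := by
    rw [hCeq]
    exact linearIndependent_act hTi hXd
  -- ### conclude
  rw [overlapTrans, strFrame_eq ν hkl S hb, hcyl, hx, compMat_map (ν.strEquiv hkl hb) hCi, hCeq]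
  exact compMat_act_right hTi hXd

end FramedSphereFamily

end Literature.Topology.FourManifolds

end

/-! ## Part: `SurgeryHandleFrameAssembly` -/

noncomputable section

open scoped Manifold ContDiff Topology RealInnerProductSpace
open Set Function Bundle Metric Module

namespace Literature.Topology.FourManifolds

open StableFrames StableFrames.SurgerySwap StableFrames.NzMat SphereSurgery

namespace FramedSphereFamily

universe u

attribute [local instance] fact_finrank_euclideanSpace_succ

variable {n k l : ℕ} {X : Type u} [TopologicalSpace X] [T2Space X] [CompactSpace X]
  [ChartedSpace (EuclideanHalfSpace (n + 1)) X] [IsManifold (𝓡∂ (n + 1)) ∞ X]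
  {ι : Type u} [Unique ι]
  (ν : FramedSphereFamily (𝓡∂ (n + 1)) X ι k (l + 1)) (hkl : k + l = n)
  (h : k + 1 + (l + 1) = n + 1 + 1) (S : SFrame n X)

/-! ### Coordinates on the handle -/

/-- The coordinates `(y, v) ∈ OD^{k+1} × Sˡ` of a point of the (one-component) handle. [folklore] -/
def hcoord (b : Handle ι k l hkl) : EuclideanSpace ℝ (Fin (k + 1)) × Metric.sphere (0 : EuclideanSpace ℝ (Fin (l + 1))) 1 :=
  ((ofHandle ι k l hkl b : ↥(ballTimesSphere ι k l)) :
    DiscreteIndex ι × (EuclideanSpace ℝ (Fin (k + 1)) × Metric.sphere (0 : EuclideanSpace ℝ (Fin (l + 1))) 1)).2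

omit [T2Space X] [CompactSpace X] [IsManifold (𝓡∂ (n + 1)) ∞ X] [Unique ι] in
/-- The coordinates are continuous. [folklore] -/
theorem continuous_hcoord : Continuous (hcoord (ι := ι) hkl) :=
  continuous_snd.comp (continuous_subtype_val.comp (continuous_ofHandle hkl))

omit [T2Space X] [CompactSpace X] [IsManifold (𝓡∂ (n + 1)) ∞ X] [Unique ι] in
/-- The first coordinate lies in the open unit ball. [folklore] -/
theorem norm_hcoord_lt (b : Handle ι k l hkl) : ‖(hcoord hkl b).1‖ < 1 :=
  (mem_ballTimesSphere_iff _).1 (ofHandle ι k l hkl b).2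

omit [T2Space X] [CompactSpace X] [IsManifold (𝓡∂ (n + 1)) ∞ X] in
/-- The handle chart inverts the coordinates (one component). [folklore] -/
theorem handleChart_hcoord (b : Handle ι k l hkl) : handleChart hkl (default : ι) (hcoord hkl b) = b := by
  have hsub : ∀ a b : DiscreteIndex ι, a = b := fun a b => Subsingleton.elim (α := ι) a b
  have hb := norm_hcoord_lt hkl b
  rw [handleChart, handleCone_apply hkl default (q := hypR (hcoord hkl b)) hb]
  conv_rhs => rw [← toHandle_ofHandle hkl b]
  congr 1
  apply Subtype.ext
  refine Prod.ext (hsub _ _) (Prod.ext rfl ?_)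
  exact radialProjection_coe_sphere _ _

/-! ### The slice of the overlap comparison matrix is null-homotopic -/

/-- The slice `(u, v) ↦ G(u/4, v)` of the overlap comparison matrix, `Sᵏ × Sˡ → GL_{n+2}(ℝ)`.
[cite: KervaireMilnorAnnals1963, §6 p. 521] -/
def sliceMap : C((Metric.sphere (0 : EuclideanSpace ℝ (Fin (k + 1))) 1) × (Metric.sphere (0 : EuclideanSpace ℝ (Fin (l + 1))) 1),
    NzMat (n + 1 + 1)) :=
  ⟨fun s => ⟨ν.overlapTrans default hkl h S ((4 : ℝ)⁻¹ • (s.1 : EuclideanSpace ℝ (Fin (k + 1))), s.2),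
      ν.det_overlapTrans_ne_zero default hkl h S
        (by rw [norm_smul, norm_eq_of_mem_sphere, mul_one]; norm_num)
        (smul_ne_zero (by norm_num) (ne_zero_of_mem_unit_sphere s.1))⟩,
    by
      refine Continuous.subtype_mk ?_ _
      have h1 : Continuous fun s : (Metric.sphere (0 : EuclideanSpace ℝ (Fin (k + 1))) 1) ×
          (Metric.sphere (0 : EuclideanSpace ℝ (Fin (l + 1))) 1) => (4 : ℝ)⁻¹ • (s.1 : EuclideanSpace ℝ (Fin (k + 1))) :=
        (continuous_const (y := (4 : ℝ)⁻¹)).smul (continuous_subtype_val.comp continuous_fst)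
      have hmap : Continuous fun s : (Metric.sphere (0 : EuclideanSpace ℝ (Fin (k + 1))) 1) ×
          (Metric.sphere (0 : EuclideanSpace ℝ (Fin (l + 1))) 1) =>
            (((4 : ℝ)⁻¹ • (s.1 : EuclideanSpace ℝ (Fin (k + 1))), s.2) :
              EuclideanSpace ℝ (Fin (k + 1)) × Metric.sphere (0 : EuclideanSpace ℝ (Fin (l + 1))) 1) :=
        h1.prodMk continuous_snd
      refine (ν.continuousOn_overlapTrans default hkl h S).comp_continuous hmap fun s => ⟨?_, ?_⟩
      · change ‖(4 : ℝ)⁻¹ • (s.1 : EuclideanSpace ℝ (Fin (k + 1)))‖ < 1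
        rw [norm_smul, norm_eq_of_mem_sphere, mul_one]; norm_num
      · exact smul_ne_zero (by norm_num) (ne_zero_of_mem_unit_sphere s.1)⟩

omit [CompactSpace X] in
/-- Values of the slice. [folklore] -/
@[simp] theorem sliceMap_apply_val (s : (Metric.sphere (0 : EuclideanSpace ℝ (Fin (k + 1))) 1) ×
    (Metric.sphere (0 : EuclideanSpace ℝ (Fin (l + 1))) 1)) :
    (ν.sliceMap hkl h S s).1 = ν.overlapTrans default hkl h S ((4 : ℝ)⁻¹ • (s.1 : EuclideanSpace ℝ (Fin (k + 1))), s.2) := rfl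

omit [CompactSpace X] in
/-- **The slice is null-homotopic** once the core transition is: `G(u/4, v) = Xmat⁻¹ · tubeTrans(u, v/4)`
with `Xmat` null-homotopic on `Sᵏ × Sˡ` (`Xmat_homotopic_const`) and `tubeTrans (u, v/4)`
contracting radially onto the core transition. [cite: KervaireMilnorAnnals1963, Lemma 6.2 (p. 522)] -/
theorem sliceMap_homotopic_const (hcore : (ν.coreTrans default h S).Homotopic (1 : C(_, NzMat (n + 1 + 1)))) :
    ∃ C₀ : NzMat (n + 1 + 1), (ContinuousMap.const _ C₀).Homotopic (ν.sliceMap hkl h S) := by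
  -- the two factors
  have hu : ∀ s : (Metric.sphere (0 : EuclideanSpace ℝ (Fin (k + 1))) 1) × (Metric.sphere (0 : EuclideanSpace ℝ (Fin (l + 1))) 1),
      ‖(s.1 : EuclideanSpace ℝ (Fin (k + 1)))‖ = 1 := fun s => norm_eq_of_mem_sphere s.1
  have hv : ∀ s : (Metric.sphere (0 : EuclideanSpace ℝ (Fin (k + 1))) 1) × (Metric.sphere (0 : EuclideanSpace ℝ (Fin (l + 1))) 1),
      ‖(s.2 : EuclideanSpace ℝ (Fin (l + 1)))‖ = 1 := fun s => norm_eq_of_mem_sphere s.2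
  have hdet : ∀ s : (Metric.sphere (0 : EuclideanSpace ℝ (Fin (k + 1))) 1) × (Metric.sphere (0 : EuclideanSpace ℝ (Fin (l + 1))) 1),
      (Xmat ((s.1 : EuclideanSpace ℝ (Fin (k + 1))), (s.2 : EuclideanSpace ℝ (Fin (l + 1)))) h (4 : ℝ)⁻¹).det ≠ 0 :=
    fun s => det_Xmat_ne_zero (p := ((s.1 : EuclideanSpace ℝ (Fin (k + 1))), (s.2 : EuclideanSpace ℝ (Fin (l + 1)))))
      (hu s) (hv s) h (by norm_num)
  have hXc : Continuous fun s : (Metric.sphere (0 : EuclideanSpace ℝ (Fin (k + 1))) 1) ×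
      (Metric.sphere (0 : EuclideanSpace ℝ (Fin (l + 1))) 1) =>
        (⟨Xmat ((s.1 : EuclideanSpace ℝ (Fin (k + 1))), (s.2 : EuclideanSpace ℝ (Fin (l + 1)))) h (4 : ℝ)⁻¹, hdet s⟩ :
          NzMat (n + 1 + 1)) :=
    (continuous_Xmat h ((continuous_subtype_val.comp continuous_fst).prodMk
      (continuous_subtype_val.comp continuous_snd)) continuous_const (fun _ => by norm_num)).subtype_mk _
  obtain ⟨P₀, hP⟩ := Xmat_homotopic_const h (θ₀ := (4 : ℝ)⁻¹) (by norm_num) hdet hXc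
  let Xm : C((Metric.sphere (0 : EuclideanSpace ℝ (Fin (k + 1))) 1) × (Metric.sphere (0 : EuclideanSpace ℝ (Fin (l + 1))) 1),
      NzMat (n + 1 + 1)) := ⟨_, hXc⟩
  have hTdet : ∀ s : (Metric.sphere (0 : EuclideanSpace ℝ (Fin (k + 1))) 1) × (Metric.sphere (0 : EuclideanSpace ℝ (Fin (l + 1))) 1),
      ∀ t : ℝ, (ν.tubeTrans default h S (s.1, t • (s.2 : EuclideanSpace ℝ (Fin (l + 1))))).det ≠ 0 :=
    fun s t => ν.det_tubeTrans_ne_zero default h S _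
  have hTc : Continuous fun s : (Metric.sphere (0 : EuclideanSpace ℝ (Fin (k + 1))) 1) ×
      (Metric.sphere (0 : EuclideanSpace ℝ (Fin (l + 1))) 1) =>
        (⟨ν.tubeTrans default h S (s.1, (4 : ℝ)⁻¹ • (s.2 : EuclideanSpace ℝ (Fin (l + 1)))), hTdet s _⟩ : NzMat (n + 1 + 1)) := by
    refine Continuous.subtype_mk ?_ _
    have h2 : Continuous fun s : (Metric.sphere (0 : EuclideanSpace ℝ (Fin (k + 1))) 1) ×
        (Metric.sphere (0 : EuclideanSpace ℝ (Fin (l + 1))) 1) => (4 : ℝ)⁻¹ • (s.2 : EuclideanSpace ℝ (Fin (l + 1))) :=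
      (continuous_const (y := (4 : ℝ)⁻¹)).smul (continuous_subtype_val.comp continuous_snd)
    exact (ν.continuous_tubeTrans default h S).comp (continuous_fst.prodMk h2)
  let Tm : C((Metric.sphere (0 : EuclideanSpace ℝ (Fin (k + 1))) 1) × (Metric.sphere (0 : EuclideanSpace ℝ (Fin (l + 1))) 1),
      NzMat (n + 1 + 1)) := ⟨_, hTc⟩
  -- `slice = Xm⁻¹ · Tm`
  have hslice : ν.sliceMap hkl h S = (invMap _).comp Xm * Tm := by
    ext s : 1
    apply Subtype.ext
    change ν.overlapTrans default hkl h S ((4 : ℝ)⁻¹ • (s.1 : EuclideanSpace ℝ (Fin (k + 1))), s.2) =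
      (Xmat ((s.1 : EuclideanSpace ℝ (Fin (k + 1))), (s.2 : EuclideanSpace ℝ (Fin (l + 1)))) h (4 : ℝ)⁻¹)⁻¹ *
        ν.tubeTrans default h S (s.1, (4 : ℝ)⁻¹ • (s.2 : EuclideanSpace ℝ (Fin (l + 1))))
    exact ν.overlapTrans_eq default hkl h S (by norm_num) (by norm_num) s.1 s.2
  -- `Tm ≃ coreTrans ∘ fst ≃ 1`
  have hHc : Continuous fun p : unitInterval × ((Metric.sphere (0 : EuclideanSpace ℝ (Fin (k + 1))) 1) ×
      (Metric.sphere (0 : EuclideanSpace ℝ (Fin (l + 1))) 1)) =>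
        ν.tubeTrans default h S (p.2.1, ((p.1 : ℝ) * (4 : ℝ)⁻¹) • (p.2.2 : EuclideanSpace ℝ (Fin (l + 1)))) := by
    have h1 : Continuous fun p : unitInterval × ((Metric.sphere (0 : EuclideanSpace ℝ (Fin (k + 1))) 1) ×
        (Metric.sphere (0 : EuclideanSpace ℝ (Fin (l + 1))) 1)) => ((p.1 : ℝ) * (4 : ℝ)⁻¹) :=
      (continuous_subtype_val.comp continuous_fst).mul continuous_const
    have h2 : Continuous fun p : unitInterval × ((Metric.sphere (0 : EuclideanSpace ℝ (Fin (k + 1))) 1) ×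
        (Metric.sphere (0 : EuclideanSpace ℝ (Fin (l + 1))) 1)) => (p.2.2 : EuclideanSpace ℝ (Fin (l + 1))) :=
      continuous_subtype_val.comp (continuous_snd.comp continuous_snd)
    exact (ν.continuous_tubeTrans default h S).comp ((continuous_fst.comp continuous_snd).prodMk (h1.smul h2))
  have h0 : ∀ s : (Metric.sphere (0 : EuclideanSpace ℝ (Fin (k + 1))) 1) × (Metric.sphere (0 : EuclideanSpace ℝ (Fin (l + 1))) 1),
      ν.tubeTrans default h S (s.1, (((0 : unitInterval) : ℝ) * (4 : ℝ)⁻¹) • (s.2 : EuclideanSpace ℝ (Fin (l + 1)))) =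
        (((ν.coreTrans default h S).comp ⟨Prod.fst, continuous_fst⟩) s).1 := by
    intro s
    rw [Set.Icc.coe_zero, zero_mul, zero_smul]
    rfl
  have h1 : ∀ s : (Metric.sphere (0 : EuclideanSpace ℝ (Fin (k + 1))) 1) × (Metric.sphere (0 : EuclideanSpace ℝ (Fin (l + 1))) 1),
      ν.tubeTrans default h S (s.1, (((1 : unitInterval) : ℝ) * (4 : ℝ)⁻¹) • (s.2 : EuclideanSpace ℝ (Fin (l + 1)))) =
        (Tm s).1 := by
    intro s
    rw [Set.Icc.coe_one, one_mul]
    rfl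
  have hTm1 : ((ν.coreTrans default h S).comp ⟨Prod.fst, continuous_fst⟩).Homotopic Tm :=
    ⟨{ toFun := fun p => ⟨ν.tubeTrans default h S (p.2.1, ((p.1 : ℝ) * (4 : ℝ)⁻¹) •
          (p.2.2 : EuclideanSpace ℝ (Fin (l + 1)))), ν.det_tubeTrans_ne_zero default h S _⟩
       continuous_toFun := hHc.subtype_mk _
       map_zero_left := fun s => Subtype.ext (h0 s)
       map_one_left := fun s => Subtype.ext (h1 s) }⟩
  have hTm2 : ((ν.coreTrans default h S).comp ⟨Prod.fst, continuous_fst⟩).Homotopic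
      ((1 : C((Metric.sphere (0 : EuclideanSpace ℝ (Fin (k + 1))) 1), NzMat (n + 1 + 1))).comp ⟨Prod.fst, continuous_fst⟩) :=
    hcore.comp (ContinuousMap.Homotopic.refl (⟨Prod.fst, continuous_fst⟩ :
      C((Metric.sphere (0 : EuclideanSpace ℝ (Fin (k + 1))) 1) × (Metric.sphere (0 : EuclideanSpace ℝ (Fin (l + 1))) 1),
        Metric.sphere (0 : EuclideanSpace ℝ (Fin (k + 1))) 1)))
  have hTm : Tm.Homotopic 1 := by
    have h1 : ((1 : C((Metric.sphere (0 : EuclideanSpace ℝ (Fin (k + 1))) 1), NzMat (n + 1 + 1))).comp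
        ⟨Prod.fst, continuous_fst⟩ : C((Metric.sphere (0 : EuclideanSpace ℝ (Fin (k + 1))) 1) ×
          (Metric.sphere (0 : EuclideanSpace ℝ (Fin (l + 1))) 1), NzMat (n + 1 + 1))) = 1 :=
      ContinuousMap.ext fun _ => rfl
    rw [h1] at hTm2
    exact hTm1.symm.trans hTm2
  -- `Xm⁻¹ ≃ const P₀⁻¹`
  have hXi : ((invMap _).comp Xm).Homotopic ((invMap _).comp (ContinuousMap.const _ P₀)) := homotopic_inv hP
  refine ⟨invMap _ P₀, ?_⟩
  have hprod := homotopic_mul hXi hTm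
  rw [← hslice] at hprod
  have hconst : (invMap (n + 1 + 1)).comp (ContinuousMap.const ((Metric.sphere (0 : EuclideanSpace ℝ (Fin (k + 1))) 1) ×
      (Metric.sphere (0 : EuclideanSpace ℝ (Fin (l + 1))) 1)) P₀) * 1 = ContinuousMap.const _ (invMap _ P₀) := by
    ext s : 1
    exact mul_one _
  rw [hconst] at hprod
  exact hprod.symm

/-! ### The interpolating matrix field on the handle -/

variable {ν hkl h S} {C₀ : NzMat (n + 1 + 1)}

/-- **The matrix field `Φ` on the handle**: the overlap comparison matrix on the shell
`‖y‖ ≥ 1/4`, the homotopy `Hs` run radially on `1/8 ≤ ‖y‖ ≤ 1/4`, the constant `C₀` on the core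
`‖y‖ ≤ 1/8`. [cite: KervaireMilnorAnnals1963, Lemma 6.2 (p. 522)] -/
def blendMat (Hs : (ContinuousMap.const ((Metric.sphere (0 : EuclideanSpace ℝ (Fin (k + 1))) 1) ×
    (Metric.sphere (0 : EuclideanSpace ℝ (Fin (l + 1))) 1)) C₀).Homotopy (ν.sliceMap hkl h S))
    (b : Handle ι k l hkl) : Matrix (Fin (n + 1 + 1)) (Fin (n + 1 + 1)) ℝ :=
  if (4 : ℝ)⁻¹ ≤ ‖(hcoord hkl b).1‖ then ν.overlapTrans default hkl h S (hcoord hkl b)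
  else (Hs (Set.projIcc (0 : ℝ) 1 zero_le_one (8 * ‖(hcoord hkl b).1‖ - 1),
    (radialProjection (spherePt k) (hcoord hkl b).1, (hcoord hkl b).2))).1

omit [CompactSpace X] in
/-- The inner (homotopy) branch of `blendMat`, as a function on the handle. [folklore] -/
theorem continuous_blendInner (Hs : (ContinuousMap.const ((Metric.sphere (0 : EuclideanSpace ℝ (Fin (k + 1))) 1) ×
    (Metric.sphere (0 : EuclideanSpace ℝ (Fin (l + 1))) 1)) C₀).Homotopy (ν.sliceMap hkl h S)) :
    Continuous fun b : Handle ι k l hkl => (Hs (Set.projIcc (0 : ℝ) 1 zero_le_one (8 * ‖(hcoord hkl b).1‖ - 1),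
      (radialProjection (spherePt k) (hcoord hkl b).1, (hcoord hkl b).2))).1 := by
  have hθ : Continuous fun b : Handle ι k l hkl => ‖(hcoord hkl b).1‖ := continuous_norm.comp (continuous_fst.comp (continuous_hcoord hkl))
  have ht : Continuous fun b : Handle ι k l hkl => Set.projIcc (0 : ℝ) 1 zero_le_one (8 * ‖(hcoord hkl b).1‖ - 1) :=
    continuous_projIcc.comp ((continuous_const.mul hθ).sub continuous_const)
  refine continuous_iff_continuousAt.2 fun b₀ => ?_
  by_cases h0 : (hcoord hkl b₀).1 = 0
  · -- near the core the field is the constant `C₀`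
    have hlt : ‖(hcoord hkl b₀).1‖ < 8⁻¹ := by rw [h0, norm_zero]; norm_num
    have hev : ∀ᶠ b in 𝓝 b₀, (Hs (Set.projIcc (0 : ℝ) 1 zero_le_one (8 * ‖(hcoord hkl b).1‖ - 1),
        (radialProjection (spherePt k) (hcoord hkl b).1, (hcoord hkl b).2))).1 = C₀.1 := by
      filter_upwards [(isOpen_lt hθ continuous_const).mem_nhds hlt] with b hb
      have hb' : 8 * ‖(hcoord hkl b).1‖ - 1 ≤ 0 := by
        have hb'' : ‖(hcoord hkl b).1‖ < 8⁻¹ := hb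
        nlinarith
      rw [Set.projIcc_of_le_left _ hb']
      change (Hs (0, _)).1 = C₀.1
      rw [Hs.apply_zero]
      rfl
    exact (continuousAt_const.congr (Filter.EventuallyEq.symm hev))
  · have hB : ContinuousAt (fun b : Handle ι k l hkl => (hcoord hkl b).1) b₀ :=
      (continuous_fst.comp (continuous_hcoord hkl)).continuousAt
    have hA : ContinuousAt (radialProjection (spherePt k)) ((hcoord hkl b₀).1) :=
      (continuousOn_radialProjection (spherePt k)).continuousAt (isOpen_ne.mem_nhds h0)
    have hρ : ContinuousAt (fun b : Handle ι k l hkl => radialProjection (spherePt k) (hcoord hkl b).1) b₀ :=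
      ContinuousAt.comp (f := fun b : Handle ι k l hkl => (hcoord hkl b).1) (x := b₀) hA hB
    have h2 : ContinuousAt (fun b : Handle ι k l hkl => (hcoord hkl b).2) b₀ :=
      (continuous_snd.comp (continuous_hcoord hkl)).continuousAt
    have hH : Continuous fun p : unitInterval × ((Metric.sphere (0 : EuclideanSpace ℝ (Fin (k + 1))) 1) ×
        (Metric.sphere (0 : EuclideanSpace ℝ (Fin (l + 1))) 1)) => (Hs p).1 :=
      continuous_subtype_val.comp Hs.continuous
    exact hH.continuousAt.comp (ht.continuousAt.prodMk (hρ.prodMk h2))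

omit [CompactSpace X] in
/-- **`Φ` is continuous.** The two branches agree on `‖y‖ = 1/4` (`Hs (1, ·) = slice`).
[folklore] -/
theorem continuous_blendMat (Hs : (ContinuousMap.const ((Metric.sphere (0 : EuclideanSpace ℝ (Fin (k + 1))) 1) ×
    (Metric.sphere (0 : EuclideanSpace ℝ (Fin (l + 1))) 1)) C₀).Homotopy (ν.sliceMap hkl h S)) :
    Continuous (blendMat Hs) := by
  have hθ : Continuous fun b : Handle ι k l hkl => ‖(hcoord hkl b).1‖ := continuous_norm.comp (continuous_fst.comp (continuous_hcoord hkl))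
  refine continuous_if (fun b hb => ?_) ?_ ?_
  · -- on the frontier `‖y‖ = 1/4`
    have hb' : (4 : ℝ)⁻¹ = ‖(hcoord hkl b).1‖ := frontier_le_subset_eq continuous_const hθ hb
    have hy0 : (hcoord hkl b).1 ≠ 0 := by
      intro h0; rw [h0, norm_zero] at hb'; norm_num at hb'
    have ht : 8 * ‖(hcoord hkl b).1‖ - 1 = 1 := by rw [← hb']; norm_num
    rw [ht, Set.projIcc_right]
    change _ = (Hs (1, _)).1
    rw [Hs.apply_one, sliceMap_apply_val]
    congr 1
    refine Prod.ext ?_ rfl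
    change (hcoord hkl b).1 = (4 : ℝ)⁻¹ • (radialProjection (spherePt k) (hcoord hkl b).1 : EuclideanSpace ℝ (Fin (k + 1)))
    rw [coe_radialProjection_of_ne_zero _ hy0, smul_smul, hb', mul_inv_cancel₀ (by rw [← hb']; norm_num), one_smul]
  · have hcl : closure {b : Handle ι k l hkl | (4 : ℝ)⁻¹ ≤ ‖(hcoord hkl b).1‖} ⊆
        {b | ‖(hcoord hkl b).1‖ < 1 ∧ (hcoord hkl b).1 ≠ 0} := by
      rw [(isClosed_le continuous_const hθ).closure_eq]
      intro b hb
      refine ⟨norm_hcoord_lt hkl b, fun h0 => ?_⟩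
      have : (4 : ℝ)⁻¹ ≤ ‖(hcoord hkl b).1‖ := hb
      rw [h0, norm_zero] at this; norm_num at this
    exact ((ν.continuousOn_overlapTrans default hkl h S).comp (continuous_hcoord hkl).continuousOn
      fun b hb => hb).mono hcl
  · exact (continuous_blendInner Hs).continuousOn

omit [CompactSpace X] in
/-- `det Φ ≠ 0`. [folklore] -/
theorem det_blendMat_ne_zero (Hs : (ContinuousMap.const ((Metric.sphere (0 : EuclideanSpace ℝ (Fin (k + 1))) 1) ×
    (Metric.sphere (0 : EuclideanSpace ℝ (Fin (l + 1))) 1)) C₀).Homotopy (ν.sliceMap hkl h S)) (b : Handle ι k l hkl) :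
    (blendMat Hs b).det ≠ 0 := by
  unfold blendMat
  split_ifs with hb
  · refine ν.det_overlapTrans_ne_zero default hkl h S (norm_hcoord_lt hkl b) fun h0 => ?_
    rw [h0, norm_zero] at hb; norm_num at hb
  · exact (Hs _).2

/-! ### The handle framing -/

/-- **The stable framing of the handle**: the handle cylinder frame acted on by `Φ`.
[cite: KervaireMilnorAnnals1963, Lemma 6.2 (p. 522)] -/
def handleSFrame (Hs : (ContinuousMap.const ((Metric.sphere (0 : EuclideanSpace ℝ (Fin (k + 1))) 1) ×
    (Metric.sphere (0 : EuclideanSpace ℝ (Fin (l + 1))) 1)) C₀).Homotopy (ν.sliceMap hkl h S)) :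
    SFrame n (Handle ι k l hkl) where
  s j b := act (handleCyl hkl (default : ι) h (hcoord hkl b)) (blendMat Hs b) j
  cont j := by
    have hF := isFrameFieldAlong_handleCyl hkl (default : ι) h (ι := ι)
    -- the sections `b ↦ handleCyl_i (hcoord b)` along `handleChart ∘ hcoord = id`
    have hw : ∀ i', Continuous fun b : Handle ι k l hkl =>
        (TotalSpace.mk' (EuclideanSpace ℝ (Fin (n + 1))) b (handleCyl hkl (default : ι) h (hcoord hkl b) i').1 :
          TangentBundle (𝓡∂ (n + 1)) (Handle ι k l hkl)) := by
      intro i'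
      have h1 : ContinuousOn (fun b : Handle ι k l hkl => (TotalSpace.mk' (EuclideanSpace ℝ (Fin (n + 1)))
          (handleChart hkl default (hcoord hkl b)) (handleCyl hkl (default : ι) h (hcoord hkl b) i').1 :
            TangentBundle (𝓡∂ (n + 1)) (Handle ι k l hkl))) univ :=
        (hF.1 i').comp ((continuous_hcoord (ι := ι) hkl).continuousOn (s := univ))
          (fun b _ => norm_hcoord_lt (ι := ι) hkl b)
      rw [continuousOn_univ] at h1
      refine h1.congr fun b => ?_
      rw [handleChart_hcoord]
    have ha : ∀ i', Continuous fun b : Handle ι k l hkl => blendMat Hs b i' j :=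
      fun i' => (continuous_apply j).comp ((continuous_apply i').comp (continuous_blendMat Hs))
    have hsum := continuousOn_totalSpaceMk_sum (I := 𝓡∂ (n + 1)) (f := fun b : Handle ι k l hkl => b) (t := univ)
      continuousOn_id (fun i' => (hw i').continuousOn) (fun i' => (ha i').continuousOn)
    rw [continuousOn_univ] at hsum
    refine hsum.congr fun b => ?_
    congr 1
    simp only [act, Prod.fst_sum, Prod.smul_fst]
    rfl
  cont₂ j := by
    have h1 : ∀ i', Continuous fun b : Handle ι k l hkl => (handleCyl hkl (default : ι) h (hcoord hkl b) i').2 := by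
      intro i'
      have : (fun b : Handle ι k l hkl => (handleCyl hkl (default : ι) h (hcoord hkl b) i').2) =
          fun b => ⟪((hcoord hkl b).2 : EuclideanSpace ℝ (Fin (l + 1))), (jbasis h i').2⟫ := by
        funext b; rw [handleCyl_apply, bF_apply]; rfl
      rw [this]
      exact (continuous_subtype_val.comp (continuous_snd.comp (continuous_hcoord hkl))).inner continuous_const
    have : (fun b : Handle ι k l hkl => (act (handleCyl hkl (default : ι) h (hcoord hkl b)) (blendMat Hs b) j).2) =
        fun b => ∑ i', blendMat Hs b i' j * (handleCyl hkl (default : ι) h (hcoord hkl b) i').2 := by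
      funext b; simp only [act, Prod.snd_sum, Prod.smul_snd, smul_eq_mul]
    rw [this]
    exact continuous_finsetSum _ fun i' _ =>
      ((continuous_apply j).comp ((continuous_apply i').comp (continuous_blendMat Hs))).mul (h1 i')
  linearIndependent b :=
    linearIndependent_act (linearIndependent_handleCyl hkl default h (norm_hcoord_lt hkl b)) (det_blendMat_ne_zero Hs b)

variable (ν hkl) in
omit [CompactSpace X] [IsManifold (𝓡∂ (n + 1)) ∞ X] in
/-- The coordinates of the glued seam point `glue (φ(u, v/2)) = (u/2, v)`. [folklore] -/
theorem hcoord_glue_seamPt (u : Metric.sphere (0 : EuclideanSpace ℝ (Fin (k + 1))) 1)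
    (v : Metric.sphere (0 : EuclideanSpace ℝ (Fin (l + 1))) 1) :
    hcoord hkl (ν.glue hkl (ν.seamPt u v)) = ((2⁻¹ : ℝ) • (u : EuclideanSpace ℝ (Fin (k + 1))), v) := by
  have hn : ‖(2⁻¹ : ℝ) • (v : EuclideanSpace ℝ (Fin (l + 1)))‖ = 2⁻¹ := by
    rw [norm_smul, norm_eq_of_mem_sphere, mul_one]; norm_num
  have hlt : ‖(((u, (2⁻¹ : ℝ) • (v : EuclideanSpace ℝ (Fin (l + 1)))) :
      Metric.sphere (0 : EuclideanSpace ℝ (Fin (k + 1))) 1 × EuclideanSpace ℝ (Fin (l + 1))).2)‖ < 1 := by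
    change ‖(2⁻¹ : ℝ) • (v : EuclideanSpace ℝ (Fin (l + 1)))‖ < 1
    rw [hn]; norm_num
  have h1 := ν.coe_fwdB_apply (i := default) hlt
  unfold hcoord
  rw [glue_apply, ofHandle_toHandle, coe_seamPt, h1]
  change SphereSurgery.polar (u, (2⁻¹ : ℝ) • (v : EuclideanSpace ℝ (Fin (l + 1)))) = _
  refine Prod.ext ?_ ?_
  · change ‖(2⁻¹ : ℝ) • (v : EuclideanSpace ℝ (Fin (l + 1)))‖ • (u : EuclideanSpace ℝ (Fin (k + 1))) = _
    rw [hn]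
  · exact radialProjection_smul _ (by norm_num) v

omit [CompactSpace X] in
/-- **The two framings agree on the seam**: on `‖y‖ = 1/2` the handle framing is the overlap
comparison matrix acting on the handle cylinder frame, i.e. the transported framing `d(glue)(S)`.
[cite: KervaireMilnorAnnals1963, Lemma 6.2 (p. 522)] -/
theorem handleSFrame_match (Hs : (ContinuousMap.const ((Metric.sphere (0 : EuclideanSpace ℝ (Fin (k + 1))) 1) ×
    (Metric.sphere (0 : EuclideanSpace ℝ (Fin (l + 1))) 1)) C₀).Homotopy (ν.sliceMap hkl h S))
    (u : Metric.sphere (0 : EuclideanSpace ℝ (Fin (k + 1))) 1) (v : Metric.sphere (0 : EuclideanSpace ℝ (Fin (l + 1))) 1)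
    (j : Fin (n + 2)) :
    (handleSFrame Hs).s j (ν.glue hkl (ν.seamPt u v)) =
      (mfderiv (𝓡∂ (n + 1)) (𝓡∂ (n + 1)) (ν.glue hkl) (ν.seamPt u v) ((S.restrict ν.complement).s j (ν.seamPt u v)).1,
        ((S.restrict ν.complement).s j (ν.seamPt u v)).2) := by
  have hc := hcoord_glue_seamPt ν hkl u v
  have hun : ‖(2⁻¹ : ℝ) • (u : EuclideanSpace ℝ (Fin (k + 1)))‖ = 2⁻¹ := by
    rw [norm_smul, norm_eq_of_mem_sphere, mul_one]; norm_num
  have hq : ‖(((2⁻¹ : ℝ) • (u : EuclideanSpace ℝ (Fin (k + 1))), v) : EuclideanSpace ℝ (Fin (k + 1)) ×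
      Metric.sphere (0 : EuclideanSpace ℝ (Fin (l + 1))) 1).1‖ < 1 := by
    change ‖(2⁻¹ : ℝ) • (u : EuclideanSpace ℝ (Fin (k + 1)))‖ < 1
    rw [hun]; norm_num
  have hif : (4 : ℝ)⁻¹ ≤ ‖(((2⁻¹ : ℝ) • (u : EuclideanSpace ℝ (Fin (k + 1))), v) : EuclideanSpace ℝ (Fin (k + 1)) ×
      Metric.sphere (0 : EuclideanSpace ℝ (Fin (l + 1))) 1).1‖ := by
    change (4 : ℝ)⁻¹ ≤ ‖(2⁻¹ : ℝ) • (u : EuclideanSpace ℝ (Fin (k + 1)))‖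
    rw [hun]; norm_num
  change act (handleCyl hkl (default : ι) h (hcoord hkl (ν.glue hkl (ν.seamPt u v))))
    (blendMat Hs (ν.glue hkl (ν.seamPt u v))) j = _
  rw [blendMat, hc, if_pos hif, ν.act_handleCyl_overlapTrans default hkl h S hq, ← hc, handleChart_hcoord,
    strFrame, (ν.glue hkl).left_inv (ν.seamPt_mem_source hkl u v)]
  rfl

/-! ### Kervaire–Milnor's Lemma 6.2 / 5.4: s-parallelizability of the surgered manifold -/

variable (ν hkl)

/-- **Kervaire–Milnor, Lemma 6.2 with Lemma 5.4** (Ann. of Math. 77 (1963), pp. 514, 521–522):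
let `X` be an s-parallelizable compact manifold (with boundary) and `ν` a framed `k`-sphere in the
interior of `X` with `k < l + 1` (`dim X = k + l + 1`, so `k` below the middle dimension). Then
the framing of the sphere can be changed (by a smooth field `α : Sᵏ → GL_{l+1}(ℝ)`, `ν.twist`) so
that the surgered manifold `χ(X, ν_α)` is s-parallelizable. Proof as printed: the obstruction
`γ(ν_α) = γ(ν) · s_*(α)` is killed using the surjectivity of `s_* : π_k(SO_{l+1}) → π_k(SO_{n+2})`
(`exists_twist_coreTrans_homotopic_one`); then the framing of `X ∖ core` transported to the
handle extends over the new core (`handleSFrame`) and the two paste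
(`isStablyParallelizable_surgered_of_seam`). [cite: KervaireMilnorAnnals1963, Lemma 5.4 (p. 514), Lemma 6.2 (p. 522)] -/
theorem exists_twist_isStablyParallelizable_surgered (hk : k < l + 1)
    (hW : IsStablyParallelizable (𝓡∂ (n + 1)) X) :
    ∃ T : TwistData k (l + 1), IsStablyParallelizable (𝓡∂ (n + 1)) ((ν.twist fun _ => T).Surgered hkl) := by
  have h : k + 1 + (l + 1) = n + 1 + 1 := by omega
  obtain ⟨S⟩ := SFrame.nonempty_of_isStablyParallelizable hW
  obtain ⟨T, hT⟩ := ν.exists_twist_coreTrans_homotopic_one (default : ι) h S hk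
  refine ⟨T, ?_⟩
  obtain ⟨C₀, hC⟩ := (ν.twist fun _ => T).sliceMap_homotopic_const hkl h S hT
  obtain ⟨Hs⟩ := hC
  exact (ν.twist fun _ => T).isStablyParallelizable_surgered_of_seam hkl (S.restrict (ν.twist fun _ => T).complement)
    (handleSFrame Hs) fun u v j => handleSFrame_match Hs u v j

end FramedSphereFamily

end Literature.Topology.FourManifolds

end
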